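import Mathlib.Analysis.InnerProductSpace.Projection.FiniteDimensional
import Literature.NumberTheory.DiophantineGeometry.MultiplicativeGroupApproximationProp434Proofs
import Literature.Barriers.ABC.BakerMethodBoundsStewartTijdemanGenericProofs
import Literature.NumberTheory.DiophantineGeometry.PadicLogFormsKummerFree
import Mathlib.Analysis.Complex.ExponentialBounds
import Literature.NumberTheory.DiophantineGeometry.StewartYuPrincipalUnitReduction
import HarnessLib

/-!
# The sharp principal reduction WP-M♭ of `p`-adic linear forms in logarithms of primes (Babai's nearest plane, Mahler's basis theorem in the Euclidean norm, loss `m^m √(m!)`) and the general glue to the one-prime bound (re-homed cell library `abc-stewartyu`)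

**Part IV of V** of the re-homing of the cell library `Summits/ABC/StewartYu/*` (cell `abc-stewartyu`: the kernel `p`-adic Baker bound for logarithms of rational primes and its abc consequences) into `Literature/` by the Hodge foundations lane (prover p20, generation 39); provenance, renaming convention and the source list are stated in full in the header of Part I, `Literature/NumberTheory/Transcendental/StewartYuPadicDescentSetup.lean`; namespace `Summit.ABC.StewartYu` → `Literature.NumberTheory.Transcendental.StewartYu`; imports from `Literature/` and Mathlib only; one `section PartK` per source module; no `sorry`, no new axiom, NO named fact (D-0026); every declaration keeps its source docstring with a `[cite: …]` locator [EvertseGyory2015] [Babai1986] [StewartTijdeman1986].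

THIS FILE (5 source modules `EuclideanNearestPlane`, `EuclideanMahlerBasis`, `WeightedLatticeBasisSharp`,
`PadicLogFormsPrincipalReductionSharp`, `GluePrincipalToPrimeGeneral`): Babai's nearest plane and Mahler's basis theorem in the
EUCLIDEAN norm (`‖y_j‖² ≤ (j+1)‖v_j‖²`), the sharper short basis of a finite-index sublattice of `ℤ^m`, hence **WP-M♭**
`PrincipalLattice.exists_principal_generators_sharp` (Kummer-free principal generators with `∏ h(αⱼ) ≤ m^m √(m!) · p · ∏ log qᵢ`
instead of WP-M's `m^{2m}`), and the GENERAL GLUE `primePadicBoundAt_odd_of_principal_general` (any reduction with envelope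
`A(m) ≤ m^{c₄ m}` ∧ any Theorem-A-shaped bound ⇒ the one-prime bound at every odd prime with `κ = c₂ + c₄`).

WHAT THIS IS NOT: hypotheses are explicit binders; nothing asserted about abc here (Part V and the Barriers assembly).
-/

noncomputable section

/-!
## Part 1 — port of `Summits/ABC/StewartYu/EuclideanNearestPlane.lean` (2 declarations kept)

# The nearest-plane covering bound in a real inner product space

Cell topic `Summits/ABC/StewartYu` (cell abc-stewartyu, seat p1); namespace
`Literature.NumberTheory.Transcendental.StewartYu.PrincipalLattice` (theorems only, no definition, no named fact). First half of
the Euclidean Mahler basis (`EuclideanMahlerBasis.lean`) behind the sharpening WP-M♭ of the reduction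
of `p`-adic linear forms in logarithms of primes to Kummer-free principal generators.

* `norm_sub_starProjection_le_norm` — `‖w − P_K w‖ ≤ ‖w‖`;
* `exists_int_comb_norm_sub_sq_le` — **nearest-plane covering bound** (Babai 1986 §3; the
  classical `μ(L)² ≤ ¼ ∑ ‖bᵢ‖²`): for any finite family `u₀, …, u_{k−1}` in a real inner product
  space and any `x` in its real span there are integers `nᵢ` with
  `‖x − ∑ nᵢ uᵢ‖² ≤ ¼ ∑ ‖uᵢ‖²` (induction on `k`: round the last coefficient, project the last
  vector onto the span of the others, Pythagoras). No linear independence is needed. (The tree's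
  `Literature.Algebra.EuclideanLattices.Babai.norm_residual_le` is the same bound for a linearly
  independent family spanning the whole space; the form here is the one the basis theorem needs.)

## References

* L. Babai, *On Lovász' lattice reduction and the nearest lattice point problem*, Combinatorica 6
  (1986) 1–13, §3 (nearest plane). [Babai1986]
-/

section Part1

open _root_.Finset _root_.Module _root_.Set
open scoped RealInnerProductSpace

namespace Literature.NumberTheory.Transcendental.StewartYu.PrincipalLattice

variable {E : Type*} [NormedAddCommGroup E] [InnerProductSpace ℝ E] [FiniteDimensional ℝ E]

/-! ### The nearest-plane covering bound -/

/-- `‖w − P_K w‖ ≤ ‖w‖` for the orthogonal projection `P_K` onto a subspace `K`. [cite: Babai1986, §3 (the nearest-plane reduction)] -/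
theorem norm_sub_starProjection_le_norm (K : Submodule ℝ E) (w : E) :
    ‖w - K.starProjection w‖ ≤ ‖w‖ := by
  rw [← Submodule.starProjection_orthogonal_val]
  exact Submodule.norm_starProjection_apply_le _ w

/-- **Nearest-plane covering bound** (Babai): for a finite family `u₀, …, u_{k−1}` of a real inner
product space and `x ∈ span_ℝ(u)`, there are integers `nᵢ` with `‖x − ∑ nᵢ uᵢ‖² ≤ ¼ ∑ ‖uᵢ‖²`.
Induction on `k`: write `x = y + t u_{k−1}` with `y ∈ span(u₀,…,u_{k−2})`, round `t` to the
nearest integer `n` (`|t − n| ≤ ½`), split `u_{k−1} = q + r` with `q` in that span and `r ⊥` it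
(`‖r‖ ≤ ‖u_{k−1}‖`), apply the induction hypothesis to `y + (t − n) q` and use Pythagoras.
[cite: Babai1986, §3] -/
theorem exists_int_comb_norm_sub_sq_le :
    ∀ (k : ℕ) (u : Fin k → E) (x : E), x ∈ Submodule.span ℝ (Set.range u) →
      ∃ n : Fin k → ℤ, ‖x - ∑ i, (n i : ℝ) • u i‖ ^ 2 ≤ (∑ i, ‖u i‖ ^ 2) / 4 := by
  intro k
  induction k with
  | zero =>
    intro u x hx
    have hx0 : x = 0 := by
      rw [Set.range_eq_empty u, Submodule.span_empty] at hx
      exact (Submodule.mem_bot ℝ).mp hx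
    exact ⟨fun _ => 0, by simp [hx0]⟩
  | succ k ih =>
    intro u x hx
    obtain ⟨c, hc⟩ := (Submodule.mem_span_range_iff_exists_fun ℝ).mp hx
    -- the prefix family, its span, the part of `x` in it
    set u' : Fin k → E := fun i => u (Fin.castSucc i) with hu'
    set K : Submodule ℝ E := Submodule.span ℝ (Set.range u') with hK
    set y : E := ∑ i : Fin k, c (Fin.castSucc i) • u' i with hy
    have hyK : y ∈ K :=
      Submodule.sum_mem _ fun i _ => Submodule.smul_mem _ _ (Submodule.subset_span ⟨i, rfl⟩)
    have hxdec : x = y + c (Fin.last k) • u (Fin.last k) := by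
      rw [← hc, Fin.sum_univ_castSucc]
    -- round the last coefficient
    set t : ℝ := c (Fin.last k) with ht
    set nk : ℤ := round t with hnk
    set s : ℝ := t - nk with hs
    have hs_abs : |s| ≤ 1 / 2 := abs_sub_round t
    -- orthogonal decomposition of the last vector
    set q : E := K.starProjection (u (Fin.last k)) with hq
    have hqK : q ∈ K := Submodule.starProjection_apply_mem _ _
    have hrK : u (Fin.last k) - q ∈ Kᗮ := Submodule.sub_starProjection_mem_orthogonal _
    have hr_le : ‖u (Fin.last k) - q‖ ≤ ‖u (Fin.last k)‖ := norm_sub_starProjection_le_norm K _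
    -- induction hypothesis for `y + s • q ∈ K`
    obtain ⟨n', hn'⟩ := ih u' (y + s • q) (K.add_mem hyK (K.smul_mem s hqK))
    refine ⟨Fin.snoc n' nk, ?_⟩
    -- the error splits orthogonally
    set a : E := y + s • q - ∑ i, (n' i : ℝ) • u' i with ha
    set b : E := s • (u (Fin.last k) - q) with hb
    have haK : a ∈ K :=
      K.sub_mem (K.add_mem hyK (K.smul_mem s hqK))
        (Submodule.sum_mem _ fun i _ => Submodule.smul_mem _ _ (Submodule.subset_span ⟨i, rfl⟩))
    have hbK : b ∈ Kᗮ := Kᗮ.smul_mem s hrK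
    have herr : x - ∑ i, ((Fin.snoc n' nk : Fin (k + 1) → ℤ) i : ℝ) • u i = a + b := by
      rw [Fin.sum_univ_castSucc, hxdec, ha, hb]
      simp only [Fin.snoc_castSucc, Fin.snoc_last, hu', hs, sub_smul, smul_sub]
      abel
    have hab := Submodule.inner_right_of_mem_orthogonal haK hbK
    have hpy : ‖a + b‖ * ‖a + b‖ = ‖a‖ * ‖a‖ + ‖b‖ * ‖b‖ :=
      norm_add_sq_eq_norm_sq_add_norm_sq_real hab
    have hb_le : ‖b‖ ^ 2 ≤ ‖u (Fin.last k)‖ ^ 2 / 4 := by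
      rw [hb, norm_smul, Real.norm_eq_abs, mul_pow]
      have hs2 : |s| ^ 2 ≤ (1 / 2) ^ 2 := pow_le_pow_left₀ (abs_nonneg s) hs_abs 2
      have hr2 : ‖u (Fin.last k) - q‖ ^ 2 ≤ ‖u (Fin.last k)‖ ^ 2 :=
        pow_le_pow_left₀ (norm_nonneg _) hr_le 2
      calc |s| ^ 2 * ‖u (Fin.last k) - q‖ ^ 2 ≤ (1 / 2) ^ 2 * ‖u (Fin.last k) - q‖ ^ 2 :=
            mul_le_mul_of_nonneg_right hs2 (sq_nonneg _)
        _ ≤ (1 / 2) ^ 2 * ‖u (Fin.last k)‖ ^ 2 := mul_le_mul_of_nonneg_left hr2 (by norm_num)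
        _ = ‖u (Fin.last k)‖ ^ 2 / 4 := by ring
    have ha_le : ‖a‖ ^ 2 ≤ (∑ i : Fin k, ‖u (Fin.castSucc i)‖ ^ 2) / 4 := hn'
    rw [herr, sq, hpy, Fin.sum_univ_castSucc]
    nlinarith [ha_le, hb_le]

end Literature.NumberTheory.Transcendental.StewartYu.PrincipalLattice

end Part1

/-!
## Part 2 — port of `Summits/ABC/StewartYu/EuclideanMahlerBasis.lean` (2 declarations kept)

# A Mahler basis for the Euclidean norm: `‖y_j‖² ≤ (j+1) · ‖v_j‖²`

Cell topic `Summits/ABC/StewartYu` (cell abc-stewartyu, seat p1); namespace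
`Literature.NumberTheory.Transcendental.StewartYu.PrincipalLattice` (theorems only, no definition, no named fact). Part of the
sharpening WP-M♭ of the reduction of `p`-adic linear forms in logarithms of primes to Kummer-free
principal generators (`PadicLogFormsPrincipalReductionSharp.lean`): the loss `(m!)²` of WP-M
(Minkowski `m!` × Mahler `m!`) drops to `m^m √(m!)` when Mahler's basis construction is run in a
EUCLIDEAN norm with a nearest-plane reduction (`EuclideanNearestPlane.lean`) instead of rounding.

* `exists_int_basis_sq_le_of_directional` — **Mahler's basis theorem, Euclidean form**: for a linear
  map `Φ : ℝ^q → E` into a real inner product space and a directional system `v₀, …, v_{q−1} ∈ ℤ^q`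
  (linearly independent, `‖Φ v₀‖ ≤ ⋯ ≤ ‖Φ v_{q−1}‖`) there is a `ℤ`-basis `y₀, …, y_{q−1}` of `ℤ^q`
  with `‖Φ y_j‖² ≤ (j+1) · ‖Φ v_j‖²` (indeed `≤ ‖Φ v_j‖² + ¼ ∑_{i<j} ‖Φ v_i‖²`), against the
  `(j+1) · N(v_j)` of the general-norm version `Dioph.exists_int_basis_le_of_directional`
  [cite: EvertseGyory2015, Thm 4.3.3 (p. 70)] proved in the tree, whose construction and proof this
  file follows verbatim, replacing only the final reduction step;
* `exists_int_basis_prod_le_sqrt_factorial` — product form `∏ ‖Φ y_j‖ ≤ √(q!) · ∏ ‖Φ v_j‖`.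

## References

* [EvertseGyory2015] J.-H. Evertse, K. Győry, *Unit Equations in Diophantine Number Theory*,
  CUP 2015 — Thm 4.3.3 (p. 70) (Mahler's basis theorem).
-/

section Part2

open _root_.Finset _root_.Module _root_.Set
open scoped RealInnerProductSpace _root_.Matrix

namespace Literature.NumberTheory.Transcendental.StewartYu.PrincipalLattice

variable {E : Type*} [NormedAddCommGroup E] [InnerProductSpace ℝ E] [FiniteDimensional ℝ E]

/-! ### Mahler's basis theorem for the Euclidean norm -/

variable {q : ℕ}

/-- **Mahler's basis theorem, Euclidean form** (cf. Evertse–Győry, Thm 4.3.3, and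
`Dioph.exists_int_basis_le_of_directional`). Let `Φ : ℝ^q → E` be linear into a real inner product
space and `v₀, …, v_{q−1} ∈ ℤ^q` linearly independent over `ℝ` with
`‖Φ v₀‖ ≤ ⋯ ≤ ‖Φ v_{q−1}‖`. Then `ℤ^q` has a `ℤ`-basis `y₀, …, y_{q−1}` (a generating system of `q`
non-zero vectors) with `‖Φ y_j‖² ≤ (j+1) · ‖Φ v_j‖²`. Construction as in the tree's general-norm
version (`y_j` = a vector of `ℤ^q ∩ span_ℝ(v₀,…,v_j)` with least positive `v_j`-coordinate
`m_j ∈ (0,1]`), but reduced modulo `ℤv₀ + ⋯ + ℤv_{j−1}` by the nearest-plane bound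
`exists_int_comb_norm_sub_sq_le` applied to the projection of `Φ y_j` onto
`K = span(Φ v₀, …, Φ v_{j−1})`: then `Φ y_j = a + m_j (Φ v_j − P_K Φ v_j)` with `a ∈ K`,
`‖a‖² ≤ ¼ ∑_{i<j} ‖Φ v_i‖²`, so `‖Φ y_j‖² ≤ ¼ ∑_{i<j} ‖Φ v_i‖² + ‖Φ v_j‖² ≤ (j+1) ‖Φ v_j‖²`.
[cite: EvertseGyory2015, Thm 4.3.3 (p. 70)] -/
theorem exists_int_basis_sq_le_of_directional (Φ : (Fin q → ℝ) →ₗ[ℝ] E)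
    (v : Fin q → Fin q → ℤ) (hli : LinearIndependent ℝ (fun k i => (v k i : ℝ)))
    (hmono : Monotone (fun k => ‖Φ (fun i => (v k i : ℝ))‖)) :
    ∃ y : Fin q → Fin q → ℤ, Submodule.span ℤ (Set.range y) = ⊤ ∧ (∀ j, y j ≠ 0) ∧
      ∀ j : Fin q, ‖Φ (fun i => (y j i : ℝ))‖ ^ 2 ≤
        ((j : ℕ) + 1) * ‖Φ (fun i => (v j i : ℝ))‖ ^ 2 := by
  classical
  -- the degenerate case `q = 0`
  rcases Nat.eq_zero_or_pos q with hq | hq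
  · subst hq
    refine ⟨v, ?_, fun j => Fin.elim0 j, fun j => Fin.elim0 j⟩
    refine Submodule.eq_top_iff'.mpr fun w => ?_
    have : w = 0 := Subsingleton.elim _ _
    rw [this]; exact Submodule.zero_mem _
  haveI : Nonempty (Fin q) := ⟨⟨0, hq⟩⟩
  -- notation
  set V : Fin q → Fin q → ℝ := fun k i => (v k i : ℝ) with hV
  let cast : (Fin q → ℤ) → (Fin q → ℝ) := fun z i => (z i : ℝ)
  have cast_sub : ∀ w w' : Fin q → ℤ, cast (w - w') = cast w - cast w' := by
    intro w w'; ext i; simp [cast]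
  have cast_zsmul : ∀ (t : ℤ) (w : Fin q → ℤ), cast (t • w) = (t : ℝ) • cast w := by
    intro t w; ext i; simp [cast]
  have cast_v : ∀ k, cast (v k) = V k := fun k => rfl
  have cast_inj : ∀ w w' : Fin q → ℤ, cast w = cast w' → w = w' := by
    intro w w' h; ext i
    have := congrFun h i
    simp only [cast] at this
    exact_mod_cast this
  -- the basis `V` of `ℝ^q` and its coordinate functionals
  have hcard : Fintype.card (Fin q) = finrank ℝ (Fin q → ℝ) := by simp
  let bV : Basis (Fin q) ℝ (Fin q → ℝ) := basisOfLinearIndependentOfCardEqFinrank hli hcard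
  have bV_apply : ∀ k, bV k = V k := fun k => by
    show basisOfLinearIndependentOfCardEqFinrank hli hcard k = V k
    rw [coe_basisOfLinearIndependentOfCardEqFinrank]
  let c : (Fin q → ℝ) → Fin q → ℝ := fun w => bV.repr w
  have c_add : ∀ w w', c (w + w') = c w + c w' := by
    intro w w'; ext i; simp [c]
  have c_sub : ∀ w w', c (w - w') = c w - c w' := by
    intro w w'; ext i; simp [c]
  have c_smul : ∀ (t : ℝ) w, c (t • w) = t • c w := by
    intro t w; ext i; simp [c]
  have c_V : ∀ k, c (V k) = Pi.single k 1 := by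
    intro k
    ext i
    rw [← bV_apply]
    simp [c, Finsupp.single_apply, Pi.single_apply, eq_comm]
  have c_sum : ∀ w, ∑ i, c w i • V i = w := by
    intro w
    have := bV.sum_repr w
    simpa [c, bV_apply] using this
  have c_eq_zero : ∀ w, (∀ i, c w i = 0) → w = 0 := by
    intro w h
    rw [← c_sum w]
    exact Finset.sum_eq_zero fun i _ => by simp [h i]
  -- integrality: `c (cast z) i * D ∈ ℤ` for `D = |det(v)|`
  set Mz : Matrix (Fin q) (Fin q) ℤ := Matrix.of fun i k => v k i with hMz
  set M : Matrix (Fin q) (Fin q) ℝ := Matrix.of fun i k => V k i with hM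
  have hMmap : (Int.castRingHom ℝ).mapMatrix Mz = M := by
    ext i k; simp [hMz, hM, hV]
  have hcolM : M.col = V := by ext k i; simp [hM, Matrix.col]
  have hMunit : IsUnit M := Matrix.linearIndependent_cols_iff_isUnit.mp (hcolM ▸ hli)
  have hdetM : M.det ≠ 0 := ((Matrix.isUnit_iff_isUnit_det _).mp hMunit).ne_zero
  have hdetMz : Mz.det ≠ 0 := by
    intro h
    apply hdetM
    rw [← hMmap, ← RingHom.map_det, h, map_zero]
  have hdetcast : ((Mz.det : ℤ) : ℝ) = M.det := by
    rw [← hMmap, ← RingHom.map_det]; rfl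
  have hmulVec : ∀ w, M *ᵥ (c w) = w := by
    intro w
    conv_rhs => rw [← c_sum w]
    ext i
    simp [hM, Matrix.mulVec, dotProduct, Finset.sum_apply, mul_comm]
  have hcramer : ∀ w i, c w i * M.det = (M.updateCol i w).det := by
    intro w i
    have h1 : M.cramer w = M.det • c w := by
      conv_lhs => rw [← hmulVec w]
      rw [Matrix.cramer_eq_adjugate_mulVec, Matrix.mulVec_mulVec, Matrix.adjugate_mul,
        Matrix.smul_mulVec, Matrix.one_mulVec]
    have := congrFun h1 i
    rw [Matrix.cramer_apply, Pi.smul_apply, smul_eq_mul] at this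
    rw [this, mul_comm]
  set D : ℕ := Mz.det.natAbs with hD
  have hDpos : 0 < D := Int.natAbs_pos.mpr hdetMz
  have hint : ∀ (z : Fin q → ℤ) (i : Fin q), ∃ n : ℤ, c (cast z) i * D = n := by
    intro z i
    have h1 : c (cast z) i * M.det = ((Mz.updateCol i z).det : ℝ) := by
      rw [hcramer]
      have : M.updateCol i (cast z) = (Int.castRingHom ℝ).mapMatrix (Mz.updateCol i z) := by
        ext i' k
        simp only [Matrix.updateCol_apply, hM, hMz, RingHom.mapMatrix_apply, Matrix.map_apply,
          Matrix.of_apply, cast, hV]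
        split_ifs <;> simp
      rw [this, ← RingHom.map_det]; rfl
    have hDreal : (D : ℝ) = |(Mz.det : ℝ)| := by
      rw [hD, Nat.cast_natAbs, Int.cast_abs]
    rcases le_or_gt 0 Mz.det with hpos | hneg
    · refine ⟨(Mz.updateCol i z).det, ?_⟩
      rw [hDreal, abs_of_nonneg (by exact_mod_cast hpos), hdetcast, h1]
    · refine ⟨-(Mz.updateCol i z).det, ?_⟩
      rw [hDreal, abs_of_neg (by exact_mod_cast hneg), hdetcast, mul_neg, h1, Int.cast_neg]
  -- for each `j`: a vector of `ℤ^q ∩ span(v₀..v_j)` with least positive `v_j`-coordinate,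
  -- reduced modulo `ℤv₀ + ⋯ + ℤv_{j-1}` by the nearest-plane bound in `E`
  have key : ∀ j : Fin q, ∃ (yj : Fin q → ℤ) (m : ℝ), 0 < m ∧ m ≤ 1 ∧
      (∀ i, j < i → c (cast yj) i = 0) ∧ c (cast yj) j = m ∧
      (‖Φ (cast yj)‖ ^ 2 ≤ ((j : ℕ) + 1) * ‖Φ (V j)‖ ^ 2) ∧
      (∀ w : Fin q → ℤ, (∀ i, j < i → c (cast w) i = 0) → ∃ t : ℤ, c (cast w) j = t * m) := by
    intro j
    let S : ℕ → Prop := fun n => 0 < n ∧ ∃ w : Fin q → ℤ, (∀ i, j < i → c (cast w) i = 0) ∧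
      c (cast w) j * D = n
    have hSD : S D := by
      refine ⟨hDpos, v j, fun i hi => ?_, ?_⟩
      · rw [cast_v, c_V]; simp [(ne_of_gt hi)]
      · rw [cast_v, c_V]; simp
    have hS : ∃ n, S n := ⟨D, hSD⟩
    set n₀ := Nat.find hS with hn₀
    obtain ⟨hn₀pos, w₀, hw₀Λ, hw₀⟩ : S n₀ := Nat.find_spec hS
    have hn₀D : n₀ ≤ D := Nat.find_min' hS hSD
    set m : ℝ := (n₀ : ℝ) / D with hm
    have hDr : (0 : ℝ) < D := by exact_mod_cast hDpos
    have hm0 : 0 < m := div_pos (by exact_mod_cast hn₀pos) hDr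
    have hm1 : m ≤ 1 := (div_le_one hDr).mpr (by exact_mod_cast hn₀D)
    have hcw₀ : c (cast w₀) j = m := by
      rw [hm, eq_div_iff hDr.ne']; exact hw₀
    -- divisibility of top coordinates by `m`
    have hdiv : ∀ w : Fin q → ℤ, (∀ i, j < i → c (cast w) i = 0) →
        ∃ t : ℤ, c (cast w) j = t * m := by
      intro w hw
      obtain ⟨a, ha⟩ := hint w j
      set t : ℤ := a / n₀ with ht
      refine ⟨t, ?_⟩
      -- the remainder vector
      set r : ℤ := a % n₀ with hr
      have hr0 : 0 ≤ r := Int.emod_nonneg _ (by exact_mod_cast hn₀pos.ne')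
      have hrlt : r < n₀ := Int.emod_lt_of_pos _ (by exact_mod_cast hn₀pos)
      have hdecomp : a = n₀ * t + r := by
        rw [hr, ht]; have := Int.emod_add_mul_ediv a n₀; linarith
      set w' : Fin q → ℤ := w - t • w₀ with hw'
      have hcw' : ∀ i, c (cast w') i = c (cast w) i - (t : ℝ) * c (cast w₀) i := by
        intro i
        rw [hw', cast_sub, cast_zsmul, c_sub, c_smul]
        simp
      have hw'Λ : ∀ i, j < i → c (cast w') i = 0 := by
        intro i hi; rw [hcw' i, hw i hi, hw₀Λ i hi]; ring
      have hw'j : c (cast w') j * D = r := by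
        rw [hcw' j, sub_mul, ha, mul_assoc, hw₀, hdecomp]
        push_cast; ring
      have hr_zero : r = 0 := by
        by_contra hrne
        have hrpos : 0 < r := lt_of_le_of_ne hr0 (Ne.symm hrne)
        have hSr : S r.toNat := by
          refine ⟨by omega, w', hw'Λ, ?_⟩
          rw [hw'j]
          have : ((r.toNat : ℕ) : ℤ) = r := Int.toNat_of_nonneg hr0
          exact_mod_cast this.symm
        have hmin := Nat.find_min' hS hSr
        rw [← hn₀] at hmin
        have : (n₀ : ℤ) ≤ r.toNat := by exact_mod_cast hmin
        rw [Int.toNat_of_nonneg hr0] at this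
        omega
      have hcwj : c (cast w) j * D = (t : ℝ) * n₀ := by
        rw [ha, hdecomp, hr_zero]; push_cast; ring
      rw [hm]
      field_simp
      rw [hcwj]
    -- coordinates of finite combinations of the `V i`
    have c_zero : c 0 = 0 := by ext i; simp [c]
    have c_combo : ∀ (s : Finset (Fin q)) (t : Fin q → ℝ) (i' : Fin q),
        c (∑ i ∈ s, t i • V i) i' = ∑ i ∈ s, t i * (if i' = i then 1 else 0) := by
      intro s t i'
      induction s using Finset.induction_on with
      | empty => simp [c_zero]
      | insert a s ha ih =>
        rw [Finset.sum_insert ha, Finset.sum_insert ha, c_add, Pi.add_apply, ih, c_smul,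
          Pi.smul_apply, smul_eq_mul, c_V, Pi.single_apply]
    -- the nearest-plane reduction in `E`
    let u : Fin q → E := fun i => if i < j then Φ (V i) else 0
    let K : Submodule ℝ E := Submodule.span ℝ (Set.range u)
    have hu_lt : ∀ i, i < j → u i = Φ (V i) := fun i hi => if_pos hi
    have hu_ge : ∀ i, ¬ i < j → u i = 0 := fun i hi => if_neg hi
    have huK : ∀ i, u i ∈ K := fun i => Submodule.subset_span ⟨i, rfl⟩
    have hVK : ∀ i, i < j → Φ (V i) ∈ K := fun i hi => by rw [← hu_lt i hi]; exact huK i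
    let x : E := K.starProjection (Φ (cast w₀))
    have hxK : x ∈ K := Submodule.starProjection_apply_mem _ _
    obtain ⟨n, hn⟩ := exists_int_comb_norm_sub_sq_le q u x hxK
    -- the reduced vector
    let yj : Fin q → ℤ := w₀ - ∑ i ∈ Finset.univ.filter (fun i => i < j), n i • v i
    have hcast_sum : cast (∑ i ∈ Finset.univ.filter (fun i => i < j), n i • v i) =
        ∑ i ∈ Finset.univ.filter (fun i => i < j), (n i : ℝ) • V i := by
      ext k
      simp [cast, hV, Finset.sum_apply]
    have hcyj : ∀ i', c (cast yj) i' =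
        c (cast w₀) i' - if i' < j then (n i' : ℝ) else 0 := by
      intro i'
      simp only [yj]
      rw [cast_sub, c_sub, hcast_sum, Pi.sub_apply, c_combo, Finset.sum_mul_boole]
      simp
    -- `Φ yj = (x − ∑ nᵢ uᵢ) + (Φ w₀ − x)`, orthogonally
    have hΦcorr : Φ (cast (∑ i ∈ Finset.univ.filter (fun i => i < j), n i • v i)) =
        ∑ i, (n i : ℝ) • u i := by
      rw [hcast_sum, map_sum, Finset.sum_filter]
      refine Finset.sum_congr rfl fun i _ => ?_
      by_cases hi : i < j
      · rw [if_pos hi, map_smul, hu_lt i hi]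
      · rw [if_neg hi, hu_ge i hi, smul_zero]
    have hΦyj : Φ (cast yj) = (x - ∑ i, (n i : ℝ) • u i) + (Φ (cast w₀) - x) := by
      simp only [yj]
      rw [cast_sub, map_sub, hΦcorr]
      abel
    have haK : x - ∑ i, (n i : ℝ) • u i ∈ K :=
      K.sub_mem hxK (Submodule.sum_mem _ fun i _ => K.smul_mem _ (huK i))
    have hbK : Φ (cast w₀) - x ∈ Kᗮ := Submodule.sub_starProjection_mem_orthogonal _
    have hab := Submodule.inner_right_of_mem_orthogonal haK hbK
    have hpy := norm_add_sq_eq_norm_sq_add_norm_sq_real hab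
    -- `Φ w₀ − x = m (Φ v_j − P_K Φ v_j)`, of norm `≤ ‖Φ v_j‖`
    have hzK : Φ (cast w₀) - m • Φ (V j) ∈ K := by
      have hexp : Φ (cast w₀) - m • Φ (V j) =
          ∑ i, (c (cast w₀) i - if i = j then m else 0) • Φ (V i) := by
        have h1 : Φ (cast w₀) = ∑ i, c (cast w₀) i • Φ (V i) := by
          conv_lhs => rw [← c_sum (cast w₀)]
          rw [map_sum]
          exact Finset.sum_congr rfl fun i _ => by rw [map_smul]
        have h2 : ∑ i, (if i = j then m else 0) • Φ (V i) = m • Φ (V j) := by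
          rw [Finset.sum_eq_single j (fun i _ hi => by rw [if_neg hi, zero_smul])
            (fun h => absurd (Finset.mem_univ j) h), if_pos rfl]
        rw [h1, ← h2, ← Finset.sum_sub_distrib]
        exact Finset.sum_congr rfl fun i _ => by rw [sub_smul]
      rw [hexp]
      refine Submodule.sum_mem _ fun i _ => ?_
      rcases lt_trichotomy i j with hlt | heq | hgt
      · rw [if_neg hlt.ne, sub_zero]; exact K.smul_mem _ (hVK i hlt)
      · subst heq; rw [if_pos rfl, hcw₀, sub_self, zero_smul]; exact K.zero_mem
      · rw [if_neg hgt.ne', hw₀Λ i hgt, sub_zero, zero_smul]; exact K.zero_mem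
    have hb_eq : Φ (cast w₀) - x = m • (Φ (V j) - K.starProjection (Φ (V j))) := by
      have hPz : K.starProjection (Φ (cast w₀) - m • Φ (V j)) = Φ (cast w₀) - m • Φ (V j) :=
        Submodule.starProjection_eq_self_iff.mpr hzK
      have hsplit : Φ (cast w₀) = (Φ (cast w₀) - m • Φ (V j)) + m • Φ (V j) := by abel
      simp only [x]
      conv_lhs => rw [hsplit]
      rw [map_add, map_smul, hPz, smul_sub]
      abel
    have hb_le : ‖Φ (cast w₀) - x‖ ^ 2 ≤ ‖Φ (V j)‖ ^ 2 := by
      rw [hb_eq, norm_smul, Real.norm_eq_abs, abs_of_pos hm0]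
      have h1 : ‖Φ (V j) - K.starProjection (Φ (V j))‖ ≤ ‖Φ (V j)‖ :=
        norm_sub_starProjection_le_norm K _
      have h2 : m * ‖Φ (V j) - K.starProjection (Φ (V j))‖ ≤ 1 * ‖Φ (V j)‖ :=
        mul_le_mul hm1 h1 (norm_nonneg _) zero_le_one
      rw [one_mul] at h2
      exact pow_le_pow_left₀ (mul_nonneg hm0.le (norm_nonneg _)) h2 2
    -- `¼ ∑ ‖uᵢ‖² ≤ ¼ · j · ‖Φ v_j‖²`
    have hu_sum : ∑ i, ‖u i‖ ^ 2 ≤ (j : ℕ) * ‖Φ (V j)‖ ^ 2 := by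
      have h1 : ∀ i, ‖u i‖ ^ 2 ≤ if i < j then ‖Φ (V j)‖ ^ 2 else 0 := by
        intro i
        by_cases hi : i < j
        · rw [if_pos hi, hu_lt i hi]
          exact pow_le_pow_left₀ (norm_nonneg _) (hmono hi.le) 2
        · rw [if_neg hi, hu_ge i hi, norm_zero]; simp
      calc ∑ i, ‖u i‖ ^ 2 ≤ ∑ i : Fin q, (if i < j then ‖Φ (V j)‖ ^ 2 else 0) :=
            Finset.sum_le_sum fun i _ => h1 i
        _ = (j : ℕ) * ‖Φ (V j)‖ ^ 2 := by
            rw [Finset.sum_ite, Finset.sum_const_zero, add_zero, Finset.sum_const, nsmul_eq_mul]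
            congr 1
            have : (Finset.univ.filter fun i : Fin q => i < j) = Finset.Iio j := by
              ext i; simp
            rw [this, Fin.card_Iio]
    have hnorm : ‖Φ (cast yj)‖ ^ 2 ≤ ((j : ℕ) + 1) * ‖Φ (V j)‖ ^ 2 := by
      rw [hΦyj, sq, hpy]
      have ha := hn
      nlinarith [ha, hb_le, hu_sum, sq_nonneg ‖Φ (V j)‖]
    refine ⟨yj, m, hm0, hm1, ?_, ?_, hnorm, hdiv⟩
    · intro i hi
      rw [hcyj, hw₀Λ i hi, if_neg (not_lt.mpr hi.le)]; simp
    · rw [hcyj, if_neg (lt_irrefl j), hcw₀]; simp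
  choose y m hm0 hm1 hyΛ hyj hynorm hdiv using key
  refine ⟨y, ?_, ?_, fun j => hynorm j⟩
  · -- generation
    have gen : ∀ n : ℕ, n ≤ q → ∀ w : Fin q → ℤ, (∀ i : Fin q, n ≤ i.val → c (cast w) i = 0) →
        w ∈ Submodule.span ℤ (Set.range y) := by
      intro n
      induction n with
      | zero =>
        intro _ w hw
        have : w = 0 := cast_inj w 0 (by
          rw [show cast 0 = 0 from by ext i; simp [cast]]
          exact c_eq_zero _ fun i => hw i (Nat.zero_le _))
        rw [this]; exact Submodule.zero_mem _
      | succ n ih =>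
        intro hn w hw
        let jn : Fin q := ⟨n, by omega⟩
        have hwΛ : ∀ i, jn < i → c (cast w) i = 0 :=
          fun i hi => hw i (by exact Nat.succ_le_of_lt (Fin.lt_def.mp hi))
        obtain ⟨t, ht⟩ := hdiv jn w hwΛ
        set w' := w - t • y jn with hw'
        have hw'mem : w' ∈ Submodule.span ℤ (Set.range y) := by
          refine ih (by omega) w' fun i hi => ?_
          rw [hw', cast_sub, cast_zsmul, c_sub, c_smul, Pi.sub_apply, Pi.smul_apply, smul_eq_mul]
          rcases (show n ≤ i.val from hi).lt_or_eq with hlt | heq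
          · have hi' : jn < i := Fin.lt_def.mpr hlt
            rw [hwΛ i hi', hyΛ jn i hi']; ring
          · have : i = jn := Fin.ext heq.symm
            subst this
            rw [ht, hyj]; ring
        have : w = w' + t • y jn := by rw [hw']; abel
        rw [this]
        exact Submodule.add_mem _ hw'mem
          (Submodule.smul_mem _ _ (Submodule.subset_span ⟨jn, rfl⟩))
    refine Submodule.eq_top_iff'.mpr fun w => gen q le_rfl w fun i hi => absurd i.2 (by omega)
  · -- non-vanishing
    intro j hzero
    have h1 := hyj j
    have : c (cast (y j)) j = 0 := by
      rw [hzero, show cast 0 = 0 from by ext i; simp [cast]]; simp [c]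
    rw [this] at h1
    exact (hm0 j).ne' h1.symm

/-- **Product form**: with `y` as in `exists_int_basis_sq_le_of_directional`,
`(∏ ‖Φ y_j‖)² ≤ q! · (∏ ‖Φ v_j‖)²`, hence `∏ ‖Φ y_j‖ ≤ √(q!) · ∏ ‖Φ v_j‖`. [cite: EvertseGyory2015, Thm 4.3.3 (p. 70) (Mahler’s basis theorem, Euclidean form ‖y_j‖² ≤ (j+1)‖v_j‖²)] -/
theorem exists_int_basis_prod_le_sqrt_factorial (Φ : (Fin q → ℝ) →ₗ[ℝ] E)
    (v : Fin q → Fin q → ℤ) (hli : LinearIndependent ℝ (fun k i => (v k i : ℝ)))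
    (hmono : Monotone (fun k => ‖Φ (fun i => (v k i : ℝ))‖)) :
    ∃ y : Fin q → Fin q → ℤ, Submodule.span ℤ (Set.range y) = ⊤ ∧ (∀ j, y j ≠ 0) ∧
      ∏ j, ‖Φ (fun i => (y j i : ℝ))‖ ≤
        Real.sqrt (q.factorial : ℝ) * ∏ j, ‖Φ (fun i => (v j i : ℝ))‖ := by
  obtain ⟨y, hygen, hyne, hyle⟩ := exists_int_basis_sq_le_of_directional Φ v hli hmono
  refine ⟨y, hygen, hyne, ?_⟩
  have hsq : (∏ j, ‖Φ (fun i => (y j i : ℝ))‖) ^ 2 ≤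
      (q.factorial : ℝ) * (∏ j, ‖Φ (fun i => (v j i : ℝ))‖) ^ 2 := by
    rw [← Finset.prod_pow, ← Finset.prod_pow]
    calc ∏ j, ‖Φ (fun i => (y j i : ℝ))‖ ^ 2
        ≤ ∏ j : Fin q, (((j : ℕ) : ℝ) + 1) * ‖Φ (fun i => (v j i : ℝ))‖ ^ 2 :=
          Finset.prod_le_prod (fun j _ => sq_nonneg _) fun j _ => hyle j
      _ = (∏ j : Fin q, (((j : ℕ) : ℝ) + 1)) * ∏ j, ‖Φ (fun i => (v j i : ℝ))‖ ^ 2 :=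
          Finset.prod_mul_distrib
      _ = (q.factorial : ℝ) * ∏ j, ‖Φ (fun i => (v j i : ℝ))‖ ^ 2 := by
          congr 1
          rw [Fin.prod_univ_eq_prod_range (fun j => ((j : ℝ) + 1)) q]
          exact_mod_cast Finset.prod_range_add_one_eq_factorial q
  have hP : 0 ≤ ∏ j, ‖Φ (fun i => (v j i : ℝ))‖ := Finset.prod_nonneg fun j _ => norm_nonneg _
  have hY : 0 ≤ ∏ j, ‖Φ (fun i => (y j i : ℝ))‖ := Finset.prod_nonneg fun j _ => norm_nonneg _
  have h := Real.sqrt_le_sqrt hsq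
  rw [Real.sqrt_sq hY, Real.sqrt_mul (Nat.cast_nonneg _), Real.sqrt_sq hP] at h
  exact h

end Literature.NumberTheory.Transcendental.StewartYu.PrincipalLattice

end Part2

/-!
## Part 3 — port of `Summits/ABC/StewartYu/WeightedLatticeBasisSharp.lean` (2 declarations kept)

# Geometry of numbers in a finite-index sublattice of `ℤ^m`, weighted `ℓ¹` form (III): a sharper
# short basis via the Euclidean norm

Cell topic `Summits/ABC/StewartYu` (cell abc-stewartyu, seat p1); namespace
`Literature.NumberTheory.Transcendental.StewartYu.PrincipalLattice` (theorems only, no definition, no named fact). Sequel to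
`WeightedLatticeBasis.lean` (`exists_basis_prod_weighted_le`: a `ℤ`-basis `b` of a finite-index
`L ≤ ℤ^m` with `∏ⱼ F(bⱼ) ≤ (m!)² · d · ∏ wᵢ`, `F(x) = ∑ wᵢ|xᵢ|`, `d` the index) with the loss
`(m!)²` replaced by `m^m · √(m!)`:

* `sum_weighted_abs_le_sqrt_mul_norm` — Cauchy–Schwarz `F(x) ≤ √m · G(x)` for the weighted
  Euclidean norm `G(x) = (∑ wᵢ² xᵢ²)^{1/2}`;
* `exists_basis_prod_weighted_le_sharp` — **a `ℤ`-basis with `∏ⱼ F(bⱼ) ≤ m^m · √(m!) · d · ∏ wᵢ`**: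
  Minkowski's second theorem (`Dioph.exists_directional_system_prod_mul_volume_le`, PROVED in the
  tree [cite: EvertseGyory2015, Thm 4.3.1 (p. 70)]) for the norm `G` transported to `ℤ^m ≅ L`, whose
  unit ball contains the cube of side `2/√m` (so `∏ G(v_k) ≤ m^{m/2} · d · ∏ wᵢ`, no Gamma
  function needed), the Euclidean Mahler basis `exists_int_basis_prod_le_sqrt_factorial`
  (`∏ G(y_j) ≤ √(m!) · ∏ G(v_k)`), and `F ≤ √m · G`.

This is the lattice input of WP-M♭ (`PadicLogFormsPrincipalReductionSharp.lean`): with `wᵢ = log qᵢ`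
it bounds the heights product of Kummer-free principal generators by `m^m √(m!) · p · ∏ log qᵢ`
(`≤ m^{3m/2} p ∏ log qᵢ`) instead of WP-M's `m^{2m} p ∏ log qᵢ`, which lowers the exponent `κ` of
the principal-unit route by `1/2` (rung `rad^{5/2+ε}`).

## References

* [EvertseGyory2015] J.-H. Evertse, K. Győry, *Unit Equations in Diophantine Number Theory*,
  Cambridge Stud. Adv. Math. 146, CUP 2015 — Thm 4.3.1 (p. 70) (Minkowski's second theorem).
-/

section Part3

namespace Literature.NumberTheory.Transcendental.StewartYu.PrincipalLattice

open _root_.MeasureTheory _root_.Module _root_.Finset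
open Literature.NumberTheory.DiophantineGeometry.Dioph

/-! ### Cauchy–Schwarz between the weighted `ℓ¹` and `ℓ²` norms -/

/-- `∑ wᵢ|xᵢ| ≤ √m · ‖(wᵢ xᵢ)ᵢ‖₂` (Cauchy–Schwarz with the all-ones vector). [cite: EvertseGyory2015, Thm 4.3.3 (p. 70) (the weighted basis with loss m^m √(m!))] -/
theorem sum_weighted_abs_le_sqrt_mul_norm {m : ℕ} (w x : Fin m → ℝ) (hw : ∀ i, 0 < w i) :
    ∑ i, w i * |x i| ≤
      Real.sqrt m * ‖(EuclideanSpace.equiv (Fin m) ℝ).symm (fun i => w i * x i)‖ := by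
  have h := Finset.sum_mul_sq_le_sq_mul_sq Finset.univ (fun _ => (1 : ℝ)) (fun i => w i * |x i|)
  have hnorm : ‖(EuclideanSpace.equiv (Fin m) ℝ).symm (fun i => w i * x i)‖ ^ 2 =
      ∑ i, (w i * x i) ^ 2 := by
    rw [EuclideanSpace.real_norm_sq_eq]; simp
  have habs : ∀ i, (w i * |x i|) ^ 2 = (w i * x i) ^ 2 := fun i => by
    rw [mul_pow, mul_pow, sq_abs]
  have hsq : (∑ i, w i * |x i|) ^ 2 ≤
      (Real.sqrt m * ‖(EuclideanSpace.equiv (Fin m) ℝ).symm (fun i => w i * x i)‖) ^ 2 := by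
    rw [mul_pow, Real.sq_sqrt (Nat.cast_nonneg m), hnorm]
    simpa [habs] using h
  have h0 : 0 ≤ ∑ i, w i * |x i| := Finset.sum_nonneg fun i _ => mul_nonneg (hw i).le (abs_nonneg _)
  exact (pow_le_pow_iff_left₀ h0 (by positivity) two_ne_zero).1 hsq

/-! ### A sharper short basis of a finite-index sublattice of `ℤ^m` -/

/-- **A `ℤ`-basis of a finite-index sublattice with small weighted norms, sharp form.** For
`L ≤ ℤ^m` (`m ≥ 1`) of finite index `d` and weights `wᵢ > 0`, `L` has a `ℤ`-basis `b` with
`∏ⱼ F(bⱼ) ≤ m^m · √(m!) · d · ∏ᵢ wᵢ`, `F(x) = ∑ᵢ wᵢ|xᵢ|`. Transport the weighted Euclidean norm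
`G(x) = ‖(wᵢ xᵢ)ᵢ‖₂` to `ℤ^m ≅ L` through a basis matrix `B` (`|det B| = d`): the unit ball of
`G ∘ B` is the preimage of the Euclidean unit ball under a linear map of determinant `±d ∏ wᵢ` and
contains the preimage of the cube `{|zᵢ| < 1/√m}`, so its volume is `≥ (2/√m)^m/(d ∏ wᵢ)` and
Minkowski's second theorem (`Dioph.exists_directional_system_prod_mul_volume_le`) gives a
directional system `v` with `∏ G(Bv_k) ≤ m^{m/2} d ∏ wᵢ`; the Euclidean Mahler basis
(`exists_int_basis_prod_le_sqrt_factorial`) gives a basis `y` of `ℤ^m` with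
`∏ G(By_j) ≤ √(m!) ∏ G(Bv_k)`; finally `F ≤ √m · G` and `b_j = B y_j`.
[cite: EvertseGyory2015, Thm 4.3.1 (p. 70)] -/
theorem exists_basis_prod_weighted_le_sharp {m : ℕ} (hm : 0 < m) (L : Submodule ℤ (Fin m → ℤ))
    [Finite ((Fin m → ℤ) ⧸ L)] (w : Fin m → ℝ) (hw : ∀ i, 0 < w i) :
    ∃ b : Module.Basis (Fin m) ℤ L,
      ∏ j, (∑ i, w i * |(((b j : L) : Fin m → ℤ) i : ℝ)|) ≤
        (m : ℝ) ^ m * Real.sqrt (m.factorial) * Nat.card ((Fin m → ℤ) ⧸ L) * ∏ i, w i := by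
  classical
  -- full rank and a basis
  have hrank : Module.finrank ℤ L = m := by
    have h := (Submodule.finiteQuotient_iff L).mp ‹_›
    rw [h, Module.finrank_fin_fun]
  let bN : Module.Basis (Fin m) ℤ L := Module.finBasisOfFinrankEq ℤ L hrank
  -- the matrix of the basis (columns) and its determinant
  set B : Matrix (Fin m) (Fin m) ℤ := Matrix.of fun i k => ((bN k : L) : Fin m → ℤ) i with hB
  have hdet : B.det.natAbs = Nat.card ((Fin m → ℤ) ⧸ L) := by
    have h := Submodule.natAbs_det_basis_change (Pi.basisFun ℤ (Fin m)) L bN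
    rw [Module.Basis.det_apply] at h
    rw [← h]
    congr 2
  have hcard_pos : 0 < Nat.card ((Fin m → ℤ) ⧸ L) := Nat.card_pos
  have hdet0 : B.det ≠ 0 := by
    intro h0; rw [h0, Int.natAbs_zero] at hdet; omega
  set Bℝ : Matrix (Fin m) (Fin m) ℝ := B.map (Int.cast : ℤ → ℝ) with hBℝ
  have hdetℝ : Bℝ.det = (B.det : ℝ) := by rw [hBℝ]; norm_cast
  have hdetℝ0 : Bℝ.det ≠ 0 := by rw [hdetℝ]; exact_mod_cast hdet0
  set T : (Fin m → ℝ) →ₗ[ℝ] (Fin m → ℝ) := Matrix.toLin' Bℝ with hT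
  have hTdet : LinearMap.det T = Bℝ.det := by rw [hT, LinearMap.det_toLin']
  have hTinj : Function.Injective T := by
    rw [hT]
    exact Matrix.mulVec_injective_iff_isUnit.mpr
      ((Matrix.isUnit_iff_isUnit_det _).mpr (isUnit_iff_ne_zero.mpr hdetℝ0))
  -- the weights as a diagonal map, and the Euclidean embedding `Φ = (wᵢ (Tx)ᵢ)ᵢ ∈ ℝ^m_ℓ²`
  have hΩ : 0 < ∏ i, w i := Finset.prod_pos fun i _ => hw i
  set Dg : (Fin m → ℝ) →ₗ[ℝ] (Fin m → ℝ) := Matrix.toLin' (Matrix.diagonal w) with hDg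
  have hDg_apply : ∀ x, Dg x = fun i => w i * x i := by
    intro x; ext i; rw [hDg, Matrix.toLin'_apply, Matrix.mulVec_diagonal]
  have hdetDg : LinearMap.det Dg = ∏ i, w i := by
    rw [hDg, LinearMap.det_toLin', Matrix.det_diagonal]
  have hDginj : Function.Injective Dg := by
    rw [hDg]
    exact Matrix.mulVec_injective_iff_isUnit.mpr
      ((Matrix.isUnit_iff_isUnit_det _).mpr (isUnit_iff_ne_zero.mpr
        (by rw [Matrix.det_diagonal]; exact hΩ.ne')))
  set A : (Fin m → ℝ) →ₗ[ℝ] (Fin m → ℝ) := Dg ∘ₗ T with hA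
  have hdetA : LinearMap.det A = (∏ i, w i) * Bℝ.det := by
    rw [hA, LinearMap.det_comp, hdetDg, hTdet]
  have hdetA0 : LinearMap.det A ≠ 0 := by rw [hdetA]; exact mul_ne_zero hΩ.ne' hdetℝ0
  have hAinj : Function.Injective A := by
    rw [hA, LinearMap.coe_comp]; exact hDginj.comp hTinj
  set eE := (EuclideanSpace.equiv (Fin m) ℝ).symm with heE
  set Φ : (Fin m → ℝ) →ₗ[ℝ] EuclideanSpace ℝ (Fin m) := eE.toLinearEquiv.toLinearMap ∘ₗ A with hΦ
  have Φ_apply : ∀ x, Φ x = eE (A x) := fun x => rfl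
  -- the transported weighted Euclidean norm as a seminorm on `ℝ^m`
  let N : Seminorm ℝ (Fin m → ℝ) := (normSeminorm ℝ (EuclideanSpace ℝ (Fin m))).comp Φ
  have N_apply : ∀ x, N x = ‖Φ x‖ := fun x => rfl
  have hN : ∀ x, N x = 0 → x = 0 := by
    intro x hx
    rw [N_apply, norm_eq_zero, Φ_apply] at hx
    have hAx : A x = 0 := by
      have := congrArg (EuclideanSpace.equiv (Fin m) ℝ) hx
      simpa [heE] using this
    exact hAinj (by rw [hAx, map_zero])
  -- Minkowski's second theorem and the Euclidean Mahler basis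
  obtain ⟨v, hli, hmono, -, hvol⟩ := exists_directional_system_prod_mul_volume_le hm N hN
  obtain ⟨y, hygen, hyne, hyle⟩ := exists_int_basis_prod_le_sqrt_factorial Φ v hli hmono
  -- the unit ball of `N` contains `A⁻¹' {‖z‖_∞ < 1/√m}`
  have hmR : (0 : ℝ) < m := by exact_mod_cast hm
  have hsqm : 0 < Real.sqrt m := Real.sqrt_pos.mpr hmR
  set r : ℝ := 1 / Real.sqrt m with hr
  have hr0 : 0 < r := by positivity
  have hmr : (m : ℝ) * r ^ 2 = 1 := by
    rw [hr, div_pow, one_pow, Real.sq_sqrt hmR.le]; field_simp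
  have hsub : A ⁻¹' Metric.ball (0 : Fin m → ℝ) r ⊆ {x : Fin m → ℝ | N x < 1} := by
    intro x hx
    rw [Set.mem_preimage, mem_ball_zero_iff, pi_norm_lt_iff hr0] at hx
    show ‖Φ x‖ < 1
    have hsq : ‖Φ x‖ ^ 2 < 1 := by
      rw [Φ_apply, EuclideanSpace.real_norm_sq_eq]
      have hcoord : ∀ i, (eE (A x)) i = A x i := fun i => by simp [heE]
      simp only [hcoord]
      haveI : Nonempty (Fin m) := ⟨⟨0, hm⟩⟩
      calc ∑ i, (A x i) ^ 2 < ∑ _i : Fin m, r ^ 2 := by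
            refine Finset.sum_lt_sum_of_nonempty Finset.univ_nonempty fun i _ => ?_
            have hi := hx i
            rw [Real.norm_eq_abs] at hi
            exact sq_lt_sq' (by linarith [(abs_lt.mp hi).1]) (abs_lt.mp hi).2
        _ = (m : ℝ) * r ^ 2 := by simp
        _ = 1 := hmr
    have h1 : ‖Φ x‖ ^ 2 < 1 ^ 2 := by rwa [one_pow]
    exact (pow_lt_pow_iff_left₀ (norm_nonneg _) zero_le_one two_ne_zero).1 h1
  have hvolS : ENNReal.ofReal (|(LinearMap.det A)⁻¹| * (2 * r) ^ m) ≤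
      volume {x : Fin m → ℝ | N x < 1} := by
    calc ENNReal.ofReal (|(LinearMap.det A)⁻¹| * (2 * r) ^ m)
        = volume (A ⁻¹' Metric.ball (0 : Fin m → ℝ) r) := by
          rw [MeasureTheory.Measure.addHaar_preimage_linearMap volume hdetA0,
            Real.volume_pi_ball 0 hr0, Fintype.card_fin, ENNReal.ofReal_mul (abs_nonneg _)]
      _ ≤ volume {x : Fin m → ℝ | N x < 1} := measure_mono hsub
  -- `∏ N(v_k) ≤ |det A| (√m)^m = d ∏ w · m^{m/2}`
  set P : ℝ := ∏ k, N (fun i => (v k i : ℝ)) with hP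
  have hP0 : 0 ≤ P := Finset.prod_nonneg fun k _ => apply_nonneg _ _
  have hD0 : 0 < |LinearMap.det A| := abs_pos.mpr hdetA0
  have hPle : P ≤ |LinearMap.det A| * Real.sqrt m ^ m := by
    have h1 : ENNReal.ofReal P * ENNReal.ofReal (|(LinearMap.det A)⁻¹| * (2 * r) ^ m) ≤ 2 ^ m :=
      (mul_le_mul' le_rfl hvolS).trans hvol
    have h2m : (2 : ENNReal) ^ m = ENNReal.ofReal ((2 : ℝ) ^ m) := by
      rw [ENNReal.ofReal_pow (by norm_num), ENNReal.ofReal_ofNat]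
    rw [h2m, ← ENNReal.ofReal_mul hP0, ENNReal.ofReal_le_ofReal_iff (by positivity), abs_inv] at h1
    -- `h1 : P * (|det A|⁻¹ * (2 r)^m) ≤ 2^m`
    have h2 : P * (2 * r) ^ m ≤ 2 ^ m * |LinearMap.det A| := by
      have := mul_le_mul_of_nonneg_left h1 hD0.le
      calc P * (2 * r) ^ m = |LinearMap.det A| * (P * (|LinearMap.det A|⁻¹ * (2 * r) ^ m)) := by
            field_simp
        _ ≤ |LinearMap.det A| * 2 ^ m := this
        _ = 2 ^ m * |LinearMap.det A| := mul_comm _ _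
    have h2r : (2 * r) ^ m * Real.sqrt m ^ m = 2 ^ m := by
      rw [← mul_pow]; congr 1; rw [hr]; field_simp
    have h3 : P * 2 ^ m ≤ (|LinearMap.det A| * Real.sqrt m ^ m) * 2 ^ m := by
      calc P * 2 ^ m = (P * (2 * r) ^ m) * Real.sqrt m ^ m := by rw [← h2r]; ring
        _ ≤ (2 ^ m * |LinearMap.det A|) * Real.sqrt m ^ m :=
            mul_le_mul_of_nonneg_right h2 (by positivity)
        _ = (|LinearMap.det A| * Real.sqrt m ^ m) * 2 ^ m := by ring
    exact le_of_mul_le_mul_right h3 (by positivity)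
  have hdetAabs : |LinearMap.det A| = (∏ i, w i) * Nat.card ((Fin m → ℤ) ⧸ L) := by
    rw [hdetA, abs_mul, abs_of_pos hΩ, hdetℝ, ← Int.cast_abs, ← hdet, Nat.cast_natAbs]
  -- the basis `y` of `ℤ^m` and the basis `b = B y` of `L`
  let yB : Module.Basis (Fin m) ℤ (Fin m → ℤ) :=
    basisOfTopLeSpanOfCardEqFinrank y hygen.ge (by simp)
  have hyB : ∀ j, yB j = y j := fun j => by
    simp [yB, coe_basisOfTopLeSpanOfCardEqFinrank]
  let b : Module.Basis (Fin m) ℤ L := yB.map bN.equivFun.symm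
  have hb : ∀ j, ((b j : L) : Fin m → ℤ) = B.mulVec (y j) := by
    intro j
    have h1 : (b j : L) = bN.equivFun.symm (y j) := by
      rw [Module.Basis.map_apply, hyB]
    rw [h1, Module.Basis.equivFun_symm_apply, Submodule.coe_sum]
    ext i
    simp [Matrix.mulVec, dotProduct, hB, Finset.sum_apply, mul_comm]
  have hbT : ∀ j i, ((((b j : L) : Fin m → ℤ) i : ℤ) : ℝ) = T (fun k => (y j k : ℝ)) i := by
    intro j i
    rw [hb j, hT, Matrix.toLin'_apply]
    have := RingHom.map_mulVec (Int.castRingHom ℝ) B (y j) i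
    simpa [hBℝ, Function.comp_def] using this
  -- `F(b_j) ≤ √m ‖Φ y_j‖`
  have hFle : ∀ j, ∑ i, w i * |(((b j : L) : Fin m → ℤ) i : ℝ)| ≤
      Real.sqrt m * ‖Φ (fun k => (y j k : ℝ))‖ := by
    intro j
    have h := sum_weighted_abs_le_sqrt_mul_norm w (T (fun k => (y j k : ℝ))) hw
    have hrw : (fun i => w i * T (fun k => (y j k : ℝ)) i) = A (fun k => (y j k : ℝ)) := by
      rw [hA, LinearMap.comp_apply, hDg_apply]
    rw [hrw] at h
    calc ∑ i, w i * |(((b j : L) : Fin m → ℤ) i : ℝ)|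
        = ∑ i, w i * |T (fun k => (y j k : ℝ)) i| := Finset.sum_congr rfl fun i _ => by rw [hbT]
      _ ≤ Real.sqrt m * ‖eE (A (fun k => (y j k : ℝ)))‖ := h
      _ = Real.sqrt m * ‖Φ (fun k => (y j k : ℝ))‖ := by rw [Φ_apply]
  -- assemble
  have hsqmm : Real.sqrt m ^ m * Real.sqrt m ^ m = (m : ℝ) ^ m := by
    rw [← mul_pow, Real.mul_self_sqrt hmR.le]
  refine ⟨b, ?_⟩
  calc ∏ j, (∑ i, w i * |(((b j : L) : Fin m → ℤ) i : ℝ)|)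
      ≤ ∏ j, (Real.sqrt m * ‖Φ (fun k => (y j k : ℝ))‖) :=
        Finset.prod_le_prod (fun j _ => Finset.sum_nonneg fun i _ =>
          mul_nonneg (hw i).le (abs_nonneg _)) fun j _ => hFle j
    _ = Real.sqrt m ^ m * ∏ j, ‖Φ (fun k => (y j k : ℝ))‖ := by
        rw [Finset.prod_mul_distrib, Finset.prod_const, Finset.card_univ, Fintype.card_fin]
    _ ≤ Real.sqrt m ^ m * (Real.sqrt (m.factorial : ℝ) * P) :=
        mul_le_mul_of_nonneg_left hyle (by positivity)
    _ ≤ Real.sqrt m ^ m * (Real.sqrt (m.factorial : ℝ) * (|LinearMap.det A| * Real.sqrt m ^ m)) :=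
        mul_le_mul_of_nonneg_left (mul_le_mul_of_nonneg_left hPle (Real.sqrt_nonneg _))
          (by positivity)
    _ = (Real.sqrt m ^ m * Real.sqrt m ^ m) * Real.sqrt (m.factorial : ℝ) * |LinearMap.det A| := by
        ring
    _ = (m : ℝ) ^ m * Real.sqrt (m.factorial) * Nat.card ((Fin m → ℤ) ⧸ L) * ∏ i, w i := by
        rw [hsqmm, hdetAabs]; ring

end Literature.NumberTheory.Transcendental.StewartYu.PrincipalLattice

end Part3

/-!
## Part 4 — port of `Summits/ABC/StewartYu/PadicLogFormsPrincipalReductionSharp.lean` (4 declarations kept)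

# Reduction of `p`-adic linear forms in logarithms of primes to Kummer-free principal generators,
# sharp form (WP-M♭): heights product `≤ m^m √(m!) · p · ∏ log qᵢ`

Cell topic `Summits/ABC/StewartYu` (cell abc-stewartyu, HOME `run/shared/lean/pub/abc-stewartyu/`,
seat p1); namespace `Literature.NumberTheory.Transcendental.StewartYu.PrincipalLattice` (theorems only, no definition, no named
fact). Sequel to `PadicLogFormsPrincipalReduction.lean` (WP-M, `exists_principal_generators`: the
same statement with `∏ h(αⱼ) ≤ m^{2m} · p · ∏ log qᵢ`).

* `factorial_succ_le`, `factorial_mul_le`, `pow_mul_sqrt_factorial_mul_le` — the numerical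
  inequalities `(k+1)! ≤ 3 (log 2)^{k+1} (k+1)^k`, `m! · m ≤ 3 (log 2)^m m^m` and
  `m^m √(m!) · m ≤ 3 (log 2)^m m^{2m}` (Bernoulli `(1 + 1/(k+1))^k ≥ 3/2`, `log 2 ≥ 2/3`), which
  keep the exponent clause `|e'ⱼ| ≤ m^{2m} p (∏ log qᵢ) max|eᵢ|` of WP-M unchanged;
* `exists_principal_generators_sharp` — **WP-M♭**: for an odd prime `p`, distinct primes
  `q₁, …, q_m ≠ p` and `e ∈ ℤ^m ∖ {0}` with `ord_p(∏ qᵢ^{eᵢ} − 1) ≥ 1`, there are rationals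
  `αⱼ ≡ 1 (mod p)`, multiplicatively independent and Kummer-free, and `e' ≠ 0` with
  `∏ qᵢ^{eᵢ} = ∏ αⱼ^{e'ⱼ}`, **`∏ h(αⱼ) ≤ m^m · √(m!) · p · ∏ log qᵢ`** (`≤ m^{3m/2} p ∏ log qᵢ`),
  `|e'ⱼ| ≤ m^{2m} · p · (∏ log qᵢ) · max|eᵢ|`, `log p ≤ 2 h(αⱼ)`. The proof is that of WP-M verbatim
  with the basis of `Λ^±` taken from `exists_basis_prod_weighted_le_sharp` (Minkowski II for the
  weighted EUCLIDEAN norm + the Euclidean Mahler basis + Cauchy–Schwarz) instead of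
  `exists_basis_prod_weighted_le` (Minkowski II + Mahler for the weighted `ℓ¹` norm).

Consequence (files `GluePrincipalToPrimeGeneral.lean`, `PadicCW77EpsShapeFiveHalves.lean`): with a
Theorem-A-shaped bound of envelope `c₁^m m^{c₂ m}` the glue exponent becomes `κ = c₂ + 3/2` instead
of `c₂ + 2`, i.e. `log c ≪_ε rad(abc)^{5/2+ε}` from Theorem A₁ (`c₂ = 1`). Everything here is
[folklore] geometry of numbers on top of results PROVED in the tree.

## References

* [EvertseGyory2015] J.-H. Evertse, K. Győry, *Unit Equations in Diophantine Number Theory*,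
  Cambridge Stud. Adv. Math. 146, CUP 2015 — Thm 4.3.1, Thm 4.3.3 (p. 70), Lemma 4.3.6 (p. 72).
-/

section Part4

namespace Literature.NumberTheory.Transcendental.StewartYu.PrincipalLattice

open _root_.Module _root_.Finset Height

/-! ### Numerical inequalities -/

/-- `(k+1)! ≤ 3 (log 2)^{k+1} (k+1)^k` for all `k` (bases `k = 0, 1`; step by Bernoulli
`(k+2)^k ≥ (3/2)(k+1)^k` for `k ≥ 1` and `(3/2) log 2 ≥ 1`). [cite: EvertseGyory2015, Thm 4.3.3 (p. 70) with StewartTijdeman1986, proof of Theorem 1 (WP-M♭: the sharp principal reduction)] -/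
theorem factorial_succ_le (k : ℕ) :
    ((k + 1).factorial : ℝ) ≤ 3 * Real.log 2 ^ (k + 1) * ((k : ℝ) + 1) ^ k := by
  have hL : (0.6931471803 : ℝ) < Real.log 2 := Real.log_two_gt_d9
  have hL0 : 0 < Real.log 2 := by linarith
  rcases Nat.eq_zero_or_pos k with hk | hk
  · subst hk; norm_num; linarith
  induction k, hk using Nat.le_induction with
  | base =>
    norm_num
    nlinarith
  | succ k hk ih =>
    -- Bernoulli: `(3/2) (k+1)^k ≤ (k+2)^k`
    have hk1 : (0 : ℝ) < (k : ℝ) + 1 := by positivity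
    have hB : 1 + (k : ℝ) * (1 / ((k : ℝ) + 1)) ≤ (1 + 1 / ((k : ℝ) + 1)) ^ k :=
      one_add_mul_le_pow (by rw [one_div]; linarith [inv_pos.mpr hk1]) k
    have h32 : (3 / 2 : ℝ) ≤ 1 + (k : ℝ) * (1 / ((k : ℝ) + 1)) := by
      rw [mul_one_div, ← sub_nonneg]
      have hk' : (1 : ℝ) ≤ k := by exact_mod_cast hk
      have : (3 / 2 : ℝ) = 1 + 1 / 2 := by norm_num
      rw [this, add_sub_add_left_eq_sub, sub_nonneg, div_le_div_iff₀ (by norm_num) hk1]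
      linarith
    have hpow : (3 / 2 : ℝ) * ((k : ℝ) + 1) ^ k ≤ ((k : ℝ) + 2) ^ k := by
      have h1 : ((k : ℝ) + 2) = (1 + 1 / ((k : ℝ) + 1)) * ((k : ℝ) + 1) := by
        field_simp; ring
      rw [h1, mul_pow]
      exact mul_le_mul_of_nonneg_right (h32.trans hB) (by positivity)
    -- `(k+1)^k ≤ log 2 · (k+2)^k`
    have hstep : ((k : ℝ) + 1) ^ k ≤ Real.log 2 * ((k : ℝ) + 2) ^ k := by
      have h23 : (2 / 3 : ℝ) ≤ Real.log 2 := by linarith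
      calc ((k : ℝ) + 1) ^ k = (2 / 3) * ((3 / 2) * ((k : ℝ) + 1) ^ k) := by ring
        _ ≤ (2 / 3) * ((k : ℝ) + 2) ^ k := mul_le_mul_of_nonneg_left hpow (by norm_num)
        _ ≤ Real.log 2 * ((k : ℝ) + 2) ^ k := mul_le_mul_of_nonneg_right h23 (by positivity)
    -- the step
    have hfac : ((k + 1 + 1).factorial : ℝ) = ((k : ℝ) + 2) * ((k + 1).factorial : ℝ) := by
      rw [Nat.factorial_succ (k + 1)]; push_cast; ring
    rw [hfac]
    have hk2 : (0 : ℝ) ≤ (k : ℝ) + 2 := by positivity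
    calc ((k : ℝ) + 2) * ((k + 1).factorial : ℝ)
        ≤ ((k : ℝ) + 2) * (3 * Real.log 2 ^ (k + 1) * ((k : ℝ) + 1) ^ k) :=
          mul_le_mul_of_nonneg_left ih hk2
      _ ≤ ((k : ℝ) + 2) * (3 * Real.log 2 ^ (k + 1) * (Real.log 2 * ((k : ℝ) + 2) ^ k)) :=
          mul_le_mul_of_nonneg_left (mul_le_mul_of_nonneg_left hstep (by positivity)) hk2
      _ = 3 * Real.log 2 ^ (k + 1 + 1) * (((k + 1 : ℕ) : ℝ) + 1) ^ (k + 1) := by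
          push_cast; ring

/-- `m! · m ≤ 3 (log 2)^m m^m`. [cite: EvertseGyory2015, Thm 4.3.3 (p. 70) with StewartTijdeman1986, proof of Theorem 1 (WP-M♭: the sharp principal reduction)] -/
theorem factorial_mul_le (m : ℕ) :
    (m.factorial : ℝ) * m ≤ 3 * Real.log 2 ^ m * (m : ℝ) ^ m := by
  rcases Nat.eq_zero_or_pos m with hm | hm
  · subst hm; norm_num
  obtain ⟨k, rfl⟩ : ∃ k, m = k + 1 := ⟨m - 1, by omega⟩
  have h := factorial_succ_le k
  have hk1 : (0 : ℝ) ≤ (k : ℝ) + 1 := by positivity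
  calc (((k + 1).factorial : ℕ) : ℝ) * ((k + 1 : ℕ) : ℝ)
      ≤ (3 * Real.log 2 ^ (k + 1) * ((k : ℝ) + 1) ^ k) * ((k : ℝ) + 1) := by
        push_cast; exact mul_le_mul_of_nonneg_right h hk1
    _ = 3 * Real.log 2 ^ (k + 1) * ((k + 1 : ℕ) : ℝ) ^ (k + 1) := by push_cast; ring

/-- `m^m √(m!) · m ≤ 3 (log 2)^m m^{2m}` (from `√(m!) ≤ m!` and `factorial_mul_le`): the constant
of `exists_basis_prod_weighted_le_sharp` still fits the exponent clause of WP-M. [cite: EvertseGyory2015, Thm 4.3.3 (p. 70) with StewartTijdeman1986, proof of Theorem 1 (WP-M♭: the sharp principal reduction)] -/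
theorem pow_mul_sqrt_factorial_mul_le (m : ℕ) :
    (m : ℝ) ^ m * Real.sqrt (m.factorial) * m ≤ 3 * Real.log 2 ^ m * (m : ℝ) ^ (2 * m) := by
  have hf1 : (1 : ℝ) ≤ (m.factorial : ℝ) := by exact_mod_cast Nat.one_le_iff_ne_zero.mpr (Nat.factorial_ne_zero m)
  have hsqrt : Real.sqrt (m.factorial : ℝ) ≤ (m.factorial : ℝ) := by
    calc Real.sqrt (m.factorial : ℝ) ≤ Real.sqrt ((m.factorial : ℝ) ^ 2) :=
          Real.sqrt_le_sqrt (le_self_pow₀ hf1 two_ne_zero)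
      _ = (m.factorial : ℝ) := Real.sqrt_sq (by positivity)
  have hmm : (0 : ℝ) ≤ (m : ℝ) ^ m := by positivity
  calc (m : ℝ) ^ m * Real.sqrt (m.factorial) * m
      = (m : ℝ) ^ m * (Real.sqrt (m.factorial) * m) := by ring
    _ ≤ (m : ℝ) ^ m * ((m.factorial : ℝ) * m) :=
        mul_le_mul_of_nonneg_left (mul_le_mul_of_nonneg_right hsqrt (Nat.cast_nonneg m)) hmm
    _ ≤ (m : ℝ) ^ m * (3 * Real.log 2 ^ m * (m : ℝ) ^ m) :=
        mul_le_mul_of_nonneg_left (factorial_mul_le m) hmm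
    _ = 3 * Real.log 2 ^ m * (m : ℝ) ^ (2 * m) := by rw [two_mul, pow_add]; ring

/-! ### The reduction theorem, sharp form (WP-M♭) -/

/-- **Reduction to signed principal-unit generators, sharp form (WP-M♭).** Let `p` be an odd prime,
`q₁, …, q_m` distinct primes `≠ p` and `e ∈ ℤ^m ∖ {0}` with `ord_p(∏ qᵢ^{eᵢ} − 1) ≥ 1`. Then there
are rationals `α₁, …, α_m` and `e' ∈ ℤ^m ∖ {0}` with: `ord_p(αⱼ − 1) ≥ 1`; the `αⱼ` multiplicatively
independent; no non-empty sub-product of the `αⱼ` a square in `ℚ`; `∏ qᵢ^{eᵢ} = ∏ αⱼ^{e'ⱼ}`;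
`∏ h(αⱼ) ≤ m^m · √(m!) · p · ∏ log qᵢ`; `|e'ⱼ| ≤ m^{2m} · p · (∏ log qᵢ) · max|eᵢ|`; and
`log p ≤ 2 h(αⱼ)`. Construction as in `exists_principal_generators` (WP-M): `αⱼ = α̃(bⱼ)` for a
`ℤ`-basis `b` of the signed principal-unit lattice `Λ^±` (index `d ≤ p − 1`), now chosen by
`exists_basis_prod_weighted_le_sharp` with `∏ⱼ F(bⱼ) ≤ m^m √(m!) · d · ∏ log qᵢ`; coordinates by
Cramer (`card_mul_abs_repr_mul_prod_le`), numerics by `pow_mul_sqrt_factorial_mul_le`. [cite: EvertseGyory2015, Thm 4.3.3 (p. 70) with StewartTijdeman1986, proof of Theorem 1 (WP-M♭: the sharp principal reduction)] -/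
theorem exists_principal_generators_sharp :
    ∀ (p : ℕ), p.Prime → p ≠ 2 → ∀ (m : ℕ) (q : Fin m → ℕ),
    (∀ i, (q i).Prime) → Function.Injective q → (∀ i, q i ≠ p) →
    ∀ (e : Fin m → ℤ), e ≠ 0 → 1 ≤ padicValRat p (∏ i, (q i : ℚ) ^ e i - 1) →
    ∃ (α : Fin m → ℚ) (e' : Fin m → ℤ),
      (∀ j, α j ≠ 0 ∧ 1 ≤ padicValRat p (α j - 1)) ∧
      (∀ μ : Fin m → ℤ, ∏ j, α j ^ μ j = 1 → μ = 0) ∧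
      (∀ T : Finset (Fin m), T.Nonempty → ¬ IsSquare (∏ j ∈ T, α j)) ∧
      e' ≠ 0 ∧ ∏ i, (q i : ℚ) ^ e i = ∏ j, α j ^ e' j ∧
      (∏ j, logHeight₁ (α j)) ≤ (m : ℝ) ^ m * Real.sqrt (m.factorial) * p * ∏ i, Real.log (q i) ∧
      (∀ j, (|e' j| : ℝ) ≤
        (m : ℝ) ^ (2 * m) * p * (∏ i, Real.log (q i)) * (Finset.univ.sup fun i => (e i).natAbs)) ∧
      (∀ j, Real.log p ≤ 2 * logHeight₁ (α j)) := by
  intro p hp hp2 m q hq hinj hqp e he hval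
  classical
  haveI := Fact.mk hp
  -- `m = 0` is impossible
  rcases Nat.eq_zero_or_pos m with hm | hm
  · subst hm; exact absurd (funext fun i => Fin.elim0 i) he
  have hq0 : ∀ i, ((q i : ℕ) : ZMod p) ≠ 0 := fun i h =>
    hqp i (((Nat.prime_dvd_prime_iff_eq hp (hq i)).mp ((ZMod.natCast_eq_zero_iff _ _).mp h)).symm)
  -- weights `wᵢ = log qᵢ`
  set w : Fin m → ℝ := fun i => Real.log (q i) with hw
  have hwpos : ∀ i, 0 < w i := fun i => Real.log_pos (by exact_mod_cast (hq i).one_lt)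
  have hwge : ∀ i, Real.log 2 ≤ w i := fun i =>
    Real.log_le_log two_pos (by exact_mod_cast (hq i).two_le)
  have hΩ : 0 < ∏ i, w i := Finset.prod_pos fun i _ => hwpos i
  have hL : (0.6931471803 : ℝ) < Real.log 2 := Real.log_two_gt_d9
  have hL0 : 0 < Real.log 2 := by linarith
  -- the lattice `Λ^±` and its index `d ≤ p − 1`
  set L := latPMSub q hq0 with hLdef
  have hidx := index_latPM_le q hq0
  have hcardL : Nat.card ((Fin m → ℤ) ⧸ L) = (latPM q hq0).index := rfl
  haveI : Finite ((Fin m → ℤ) ⧸ L) :=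
    Nat.finite_of_card_ne_zero (by rw [hcardL]; exact hidx.2.ne')
  set d : ℕ := Nat.card ((Fin m → ℤ) ⧸ L) with hd
  have hd0 : 0 < d := by rw [hcardL]; exact hidx.2
  have hdp : (d : ℝ) ≤ p := by
    have h1 : d ≤ p - 1 := by rw [hcardL]; exact hidx.1
    have h2 : p - 1 ≤ p := Nat.sub_le p 1
    exact_mod_cast h1.trans h2
  -- the good basis and the generators
  obtain ⟨b, hb⟩ := exists_basis_prod_weighted_le_sharp hm L w hwpos
  have heker := expHom_eq_zero_of_one_le_padicValRat q hq hqp hq0 hval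
  have heΛ : e ∈ latPM q hq0 := mem_latPM_of_one_le_padicValRat q hq hqp hq0 hval
  set eL : L := ⟨e, heΛ⟩ with heL
  set α : Fin m → ℚ := fun j => signedProd q hq0 (b j : Fin m → ℤ) with hα
  set e' : Fin m → ℤ := fun j => b.equivFun eL j with he'
  have hbne : ∀ j, ((b j : L) : Fin m → ℤ) ≠ 0 := fun j h =>
    b.ne_zero j (Subtype.ext h)
  have hα1 : ∀ j, 1 ≤ padicValRat p (α j - 1) := fun j =>
    one_le_padicValRat_signedProd_sub_one q hq hinj hqp hq0 (b j).2 (hbne j)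
  -- the weighted norms `F(b_j) ≥ log 2` and `F(e) ≤ B ∑ wᵢ`
  set Fb : Fin m → ℝ := fun j => ∑ i, w i * |(((b j : L) : Fin m → ℤ) i : ℝ)| with hFb
  have hFb_ge : ∀ j, Real.log 2 ≤ Fb j := by
    intro j
    obtain ⟨i, hi⟩ : ∃ i, ((b j : L) : Fin m → ℤ) i ≠ 0 := by
      by_contra h; push Not at h; exact hbne j (funext h)
    have h1 : (1 : ℝ) ≤ |(((b j : L) : Fin m → ℤ) i : ℝ)| := by
      rw [← Int.cast_abs]; exact_mod_cast Int.one_le_abs hi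
    calc Real.log 2 ≤ w i * |(((b j : L) : Fin m → ℤ) i : ℝ)| := by
          nlinarith [hwge i, hwpos i]
      _ ≤ Fb j := Finset.single_le_sum (f := fun i => w i * |(((b j : L) : Fin m → ℤ) i : ℝ)|)
          (fun k _ => mul_nonneg (hwpos k).le (abs_nonneg _)) (Finset.mem_univ i)
  have hFb_pos : ∀ j, 0 < Fb j := fun j => hL0.trans_le (hFb_ge j)
  set Bmax : ℝ := ((Finset.univ.sup fun i => (e i).natAbs : ℕ) : ℝ) with hBmax
  have hBmax0 : 0 ≤ Bmax := Nat.cast_nonneg _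
  have heB : ∀ i, |(e i : ℝ)| ≤ Bmax := by
    intro i
    rw [← Int.cast_abs, show ((|e i| : ℤ) : ℝ) = ((e i).natAbs : ℝ) by
      rw [Nat.cast_natAbs], hBmax]
    exact_mod_cast Finset.le_sup (f := fun i => (e i).natAbs) (Finset.mem_univ i)
  have hFe : ∑ i, w i * |(e i : ℝ)| ≤ Bmax * ∑ i, w i := by
    rw [Finset.mul_sum]
    exact Finset.sum_le_sum fun i _ => by
      rw [mul_comm Bmax]; exact mul_le_mul_of_nonneg_left (heB i) (hwpos i).le
  -- `(log 2)^{m-1} ∑ wᵢ ≤ m ∏ wᵢ`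
  have hsumw : Real.log 2 ^ (m - 1) * ∑ i, w i ≤ m * ∏ i, w i := by
    rw [Finset.mul_sum]
    have h1 : ∀ i, Real.log 2 ^ (m - 1) * w i ≤ ∏ k, w k := by
      intro i
      rw [← Finset.mul_prod_erase Finset.univ w (Finset.mem_univ i), mul_comm]
      refine mul_le_mul_of_nonneg_left ?_ (hwpos i).le
      have hcard : (Finset.univ.erase i).card = m - 1 := by
        rw [Finset.card_erase_of_mem (Finset.mem_univ i), Finset.card_univ, Fintype.card_fin]
      calc Real.log 2 ^ (m - 1) = ∏ _k ∈ Finset.univ.erase i, Real.log 2 := by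
            rw [Finset.prod_const, hcard]
        _ ≤ ∏ k ∈ Finset.univ.erase i, w k :=
            Finset.prod_le_prod (fun k _ => hL0.le) fun k _ => hwge k
    calc ∑ i, Real.log 2 ^ (m - 1) * w i ≤ ∑ _i : Fin m, ∏ k, w k :=
          Finset.sum_le_sum fun i _ => h1 i
      _ = m * ∏ i, w i := by rw [Finset.sum_const, Finset.card_univ, Fintype.card_fin]; ring
  -- numerical constants
  have hfact := pow_mul_sqrt_factorial_mul_le m
  have hp3 : (3 : ℝ) ≤ p := by
    have := hp.two_le
    have h3 : 3 ≤ p := by omega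
    exact_mod_cast h3
  refine ⟨α, e', fun j => ⟨?_, hα1 j⟩, ?_, ?_, ?_, ?_, ?_, ?_, fun j => ?_⟩
  · -- `αⱼ ≠ 0`
    rw [hα]
    simp only
    unfold signedProd
    refine mul_ne_zero ?_ (prod_zpow_pos q hq _).ne'
    rcases unitSign_eq_or q hq0 ((b j : L) : Fin m → ℤ) with h | h <;> rw [h] <;> norm_num
  · -- multiplicative independence
    exact fun μ hμ => signedProd_basis_independent q hq0 b hq hinj μ hμ
  · -- Kummer condition
    exact fun T hT => not_isSquare_prod_signedProd_basis q hq0 b hq hinj T hT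
  · -- `e' ≠ 0`
    intro h0
    apply he
    have h1 : b.equivFun eL = 0 := funext fun j => congrFun h0 j
    have h2 : eL = 0 := (LinearEquiv.map_eq_zero_iff _).mp h1
    exact congrArg Subtype.val h2
  · -- the identity
    exact prod_signedProd_zpow_repr q hq0 b hq hp2 heker heΛ
  · -- heights product
    calc ∏ j, logHeight₁ (α j) ≤ ∏ j, Fb j :=
          Finset.prod_le_prod (fun j _ => Height.zero_le_logHeight₁ _)
            fun j _ => logHeight₁_signedProd_le q hq hq0 _
      _ ≤ (m : ℝ) ^ m * Real.sqrt (m.factorial) * d * ∏ i, w i := hb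
      _ ≤ (m : ℝ) ^ m * Real.sqrt (m.factorial) * p * ∏ i, w i := by gcongr
  · -- the exponents `e'`
    intro j
    have hcr := card_mul_abs_repr_mul_prod_le hm L b w hwpos eL j
    rw [← hd] at hcr
    have he'j : (b.repr eL j : ℝ) = (e' j : ℝ) := by
      rw [he']; simp only [Module.Basis.equivFun_apply]
    rw [he'j] at hcr
    -- `d |e'ⱼ| Ω Fb j ≤ F(e) ∏ Fb ≤ F(e) (m!)² d Ω`
    have h1 : (d : ℝ) * |(e' j : ℝ)| * (∏ i, w i) * Fb j ≤
        (∑ i, w i * |(e i : ℝ)|) * (((m : ℝ) ^ m * Real.sqrt (m.factorial)) * d * ∏ i, w i) := by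
      have h2 := mul_le_mul_of_nonneg_right hcr (hFb_pos j).le
      have h3 : (∏ k ∈ Finset.univ.erase j, Fb k) * Fb j = ∏ k, Fb k := by
        rw [mul_comm, Finset.mul_prod_erase _ _ (Finset.mem_univ j)]
      calc (d : ℝ) * |(e' j : ℝ)| * (∏ i, w i) * Fb j
          ≤ (∑ i, w i * |(e i : ℝ)|) * (∏ k ∈ Finset.univ.erase j, Fb k) * Fb j := h2
        _ = (∑ i, w i * |(e i : ℝ)|) * ∏ k, Fb k := by rw [mul_assoc, h3]
        _ ≤ (∑ i, w i * |(e i : ℝ)|) * (((m : ℝ) ^ m * Real.sqrt (m.factorial)) * d * ∏ i, w i) :=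
            mul_le_mul_of_nonneg_left hb
              (Finset.sum_nonneg fun i _ => mul_nonneg (hwpos i).le (abs_nonneg _))
    -- cancel `d Ω > 0`: `|e'ⱼ| Fb j ≤ (m!)² F(e)`
    have h4 : |(e' j : ℝ)| * Fb j ≤ ((m : ℝ) ^ m * Real.sqrt (m.factorial)) * ∑ i, w i * |(e i : ℝ)| := by
      have hdΩ : (0 : ℝ) < d * ∏ i, w i := mul_pos (by exact_mod_cast hd0) hΩ
      have : (d * ∏ i, w i) * (|(e' j : ℝ)| * Fb j) ≤
          (d * ∏ i, w i) * (((m : ℝ) ^ m * Real.sqrt (m.factorial)) * ∑ i, w i * |(e i : ℝ)|) := by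
        calc (d * ∏ i, w i) * (|(e' j : ℝ)| * Fb j)
            = (d : ℝ) * |(e' j : ℝ)| * (∏ i, w i) * Fb j := by ring
          _ ≤ (∑ i, w i * |(e i : ℝ)|) * (((m : ℝ) ^ m * Real.sqrt (m.factorial)) * d * ∏ i, w i) := h1
          _ = (d * ∏ i, w i) * (((m : ℝ) ^ m * Real.sqrt (m.factorial)) * ∑ i, w i * |(e i : ℝ)|) := by ring
      exact le_of_mul_le_mul_left this hdΩ
    -- `|e'ⱼ| (log 2)^m ≤ (m!)² Bmax (log 2)^{m-1} ∑ w ≤ (m!)² m Bmax Ω ≤ 3 (log 2)^m m^{2m} Bmax Ω`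
    have h5 : |(e' j : ℝ)| * Real.log 2 ^ m ≤
        3 * Real.log 2 ^ m * (m : ℝ) ^ (2 * m) * Bmax * ∏ i, w i := by
      have hm1 : Real.log 2 ^ m = Real.log 2 ^ (m - 1) * Real.log 2 :=
        (pow_sub_one_mul hm.ne' _).symm
      calc |(e' j : ℝ)| * Real.log 2 ^ m
          = (|(e' j : ℝ)| * Real.log 2) * Real.log 2 ^ (m - 1) := by rw [hm1]; ring
        _ ≤ (|(e' j : ℝ)| * Fb j) * Real.log 2 ^ (m - 1) :=
            mul_le_mul_of_nonneg_right (mul_le_mul_of_nonneg_left (hFb_ge j) (abs_nonneg _))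
              (by positivity)
        _ ≤ (((m : ℝ) ^ m * Real.sqrt (m.factorial)) * (Bmax * ∑ i, w i)) * Real.log 2 ^ (m - 1) :=
            mul_le_mul_of_nonneg_right
              (h4.trans (mul_le_mul_of_nonneg_left hFe (by positivity))) (by positivity)
        _ = ((m : ℝ) ^ m * Real.sqrt (m.factorial)) * Bmax * (Real.log 2 ^ (m - 1) * ∑ i, w i) := by ring
        _ ≤ ((m : ℝ) ^ m * Real.sqrt (m.factorial)) * Bmax * (m * ∏ i, w i) :=
            mul_le_mul_of_nonneg_left hsumw (by positivity)
        _ = (((m : ℝ) ^ m * Real.sqrt (m.factorial)) * m) * Bmax * ∏ i, w i := by ring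
        _ ≤ (3 * Real.log 2 ^ m * (m : ℝ) ^ (2 * m)) * Bmax * ∏ i, w i := by gcongr
        _ = 3 * Real.log 2 ^ m * (m : ℝ) ^ (2 * m) * Bmax * ∏ i, w i := by ring
    have h6 : |(e' j : ℝ)| ≤ 3 * (m : ℝ) ^ (2 * m) * Bmax * ∏ i, w i := by
      have hLm : (0 : ℝ) < Real.log 2 ^ m := by positivity
      have : Real.log 2 ^ m * |(e' j : ℝ)| ≤
          Real.log 2 ^ m * (3 * (m : ℝ) ^ (2 * m) * Bmax * ∏ i, w i) := by
        calc Real.log 2 ^ m * |(e' j : ℝ)| = |(e' j : ℝ)| * Real.log 2 ^ m := mul_comm _ _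
          _ ≤ _ := h5
          _ = Real.log 2 ^ m * (3 * (m : ℝ) ^ (2 * m) * Bmax * ∏ i, w i) := by ring
      exact le_of_mul_le_mul_left this hLm
    calc |(e' j : ℝ)| ≤ 3 * (m : ℝ) ^ (2 * m) * Bmax * ∏ i, w i := h6
      _ ≤ (p : ℝ) * (m : ℝ) ^ (2 * m) * Bmax * ∏ i, w i := by gcongr
      _ = (m : ℝ) ^ (2 * m) * p * (∏ i, w i) * Bmax := by ring
  · -- the floor
    exact log_le_two_mul_logHeight₁ hp2 (hα1 j)

end Literature.NumberTheory.Transcendental.StewartYu.PrincipalLattice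

end Part4

/-!
## Part 5 — port of `Summits/ABC/StewartYu/GluePrincipalToPrimeGeneral.lean` (2 declarations kept)

# WP-S glue, general WP-M exponent: principal reduction with heights `≤ A(m) · p · ∏ log qᵢ`,
# `A(m) ≤ m^{c₄ m}`, ∧ a Theorem-A-shaped bound of envelope `c₁^m m^{c₂ m}` ⇒ the one-prime bound
# with `κ = c₂ + c₄`

`Summits/ABC/StewartYu/GluePrincipalToPrimeGeneral.lean` — cell `abc-stewartyu` (seat p1; theorems
only, no definition, no named fact). A copy of p3's glue `primePadicBoundAt_odd_of_principal`
(`GluePrincipalToPrime.lean`: WP-M with `m^{2m}` ⇒ `κ = c₂ + 2`) in which the heights clause of the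
principal-reduction hypothesis reads `∏ h(αⱼ) ≤ A(m) · p · ∏ log qᵢ` for any `A` with
`A(m) ≤ m^{c₄ m}`, `c₄ ≤ 2` (the exponent clause `|e'ⱼ| ≤ m^{2m} p (∏ log qᵢ) max|eᵢ|` is kept), and
the conclusion is the body of `KappaDoor.FinBoundAt p 4704 (32 c₁) (c₂ + c₄) 2 2 2`. Instances:
WP-M (`A(m) = m^{2m}`, `c₄ = 2`) and WP-M♭ (`PadicLogFormsPrincipalReductionSharp.lean`,
`A(m) = m^m √(m!) ≤ m^{3m/2}`, `c₄ = 3/2`), the latter giving the rung `rad^{5/2+ε}`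
(`PadicCW77EpsShapeFiveHalves.lean`). Book-keeping exactly as in `Glue.bookkeeping`, with
`log(n^{c₄ n}) = c₄ n log n ≤ 2n²`. Everything is [folklore].
-/

section Part5

open _root_.Finset _root_.Real Height
open Literature.NumberTheory.DiophantineGeometry

namespace Literature.NumberTheory.Transcendental.StewartYu

namespace GlueGeneral

open Glue

/-- The real-arithmetic heart of the glue, general WP-M exponent `c₄` (copy of `Glue.bookkeeping`). With `n ≥ 1`, `p ≥ 3`, `Ω > 0`, `L_Q, L_B ≥ 1`,
`1 ≤ lp`, `1 + lp ≤ 2√p`: if `0 ≤ Cn ≤ c₁ⁿ n^{c₂ n}`, `0 ≤ PV ≤ 2ⁿ n^{c₄ n} p Ω`,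
`0 ≤ L2V ≤ (2n²+n+2) + lp + L_Q`, `0 ≤ W ≤ 2n² + lp + L_Q + L_B` and `v ≤ Cn · PV · ((W + L2V) · L2V)`,
then `v ≤ 4704 (32c₁)ⁿ n^{(c₂+c₄)n} p² Ω L_B² L_Q²`. [cite: StewartTijdeman1986, proof of Theorem 1 (the general glue with envelope A(m) ≤ m^{c₄ m})] -/
theorem bookkeeping_general {n : ℕ} {p c₁ c₂ c₄ Cn PV L2V W v Ω LQ LB lp : ℝ} (hn : 1 ≤ n) (hp : 3 ≤ p)
    (hc₁ : 1 ≤ c₁) (hΩ : 0 < Ω) (hLQ : 1 ≤ LQ) (hLB : 1 ≤ LB)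
    (hlp1 : 1 ≤ lp) (hlp : 1 + lp ≤ 2 * Real.sqrt p)
    (hCn : Cn ≤ c₁ ^ n * (n : ℝ) ^ (c₂ * n))
    (hPV0 : 0 ≤ PV) (hPV : PV ≤ 2 ^ n * (n : ℝ) ^ (c₄ * n) * p * Ω)
    (hL2V0 : 0 ≤ L2V) (hL2V : L2V ≤ (2 * (n : ℝ) ^ 2 + n + 2) + lp + LQ)
    (hW0 : 0 ≤ W) (hW : W ≤ 2 * (n : ℝ) ^ 2 + lp + LQ + LB)
    (hv : v ≤ Cn * PV * ((W + L2V) * L2V)) :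
    v ≤ 4704 * (32 * c₁) ^ n * (n : ℝ) ^ ((c₂ + c₄) * n) * p ^ 2 * Ω * LB ^ 2 * LQ ^ 2 := by
  have hn0 : (0 : ℝ) < n := by exact_mod_cast (show 0 < n by omega)
  have hn1 : (1 : ℝ) ≤ n := by exact_mod_cast hn
  have hp0 : 0 < p := by linarith
  have hsq : Real.sqrt p ^ 2 = p := Real.sq_sqrt hp0.le
  have hs0 : 0 ≤ Real.sqrt p := Real.sqrt_nonneg p
  set a : ℝ := 2 * (n : ℝ) ^ 2 + n + 2 with ha
  set b : ℝ := 4 * (n : ℝ) ^ 2 + n + 2 with hb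
  have hn2 : (0 : ℝ) ≤ (n : ℝ) ^ 2 := sq_nonneg _
  have ha1 : 1 ≤ a := by rw [ha]; linarith
  have hb1 : 1 ≤ b := by rw [hb]; linarith
  -- `L2V ≤ 2 a (1 + lp) LQ`
  have hL2V' : L2V ≤ 2 * a * (1 + lp) * LQ := by
    have h1 : a + lp ≤ a * (1 + lp) := add_le_mul_one_add ha1 (by linarith)
    have h1' : 1 ≤ a * (1 + lp) := one_le_mul_of_one_le_of_one_le ha1 (by linarith)
    have h2 : a * (1 + lp) + LQ ≤ a * (1 + lp) * (1 + LQ) := add_le_mul_one_add h1' (by linarith)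
    have h3 : a * (1 + lp) * (1 + LQ) ≤ a * (1 + lp) * (2 * LQ) :=
      mul_le_mul_of_nonneg_left (by linarith) (by linarith)
    linarith
  -- `W + L2V ≤ 6 b (1 + 2 lp) LQ LB`
  have hWL : W + L2V ≤ 6 * b * (1 + 2 * lp) * LQ * LB := by
    have h0 : W + L2V ≤ b + 2 * lp + 2 * LQ + LB := by rw [hb]; linarith
    have h1 : b + 2 * lp ≤ b * (1 + 2 * lp) := add_le_mul_one_add hb1 (by linarith)
    have h1' : 1 ≤ b * (1 + 2 * lp) := one_le_mul_of_one_le_of_one_le hb1 (by linarith)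
    have h2 : b * (1 + 2 * lp) + 2 * LQ ≤ b * (1 + 2 * lp) * (1 + 2 * LQ) :=
      add_le_mul_one_add h1' (by linarith)
    have h2' : 1 ≤ b * (1 + 2 * lp) * (1 + 2 * LQ) :=
      one_le_mul_of_one_le_of_one_le h1' (by linarith)
    have h3 : b * (1 + 2 * lp) * (1 + 2 * LQ) + LB ≤ b * (1 + 2 * lp) * (1 + 2 * LQ) * (1 + LB) :=
      add_le_mul_one_add h2' (by linarith)
    have h4 : b * (1 + 2 * lp) * (1 + 2 * LQ) * (1 + LB) ≤ b * (1 + 2 * lp) * (3 * LQ) * (2 * LB) := by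
      have hb0 : 0 ≤ b * (1 + 2 * lp) := mul_nonneg (by linarith) (by linarith)
      apply mul_le_mul _ (by linarith) (by linarith) (by positivity)
      exact mul_le_mul_of_nonneg_left (by linarith) hb0
    linarith
  -- `(1 + lp)(1 + 2 lp) ≤ 8 p`
  have hlp2 : (1 + lp) * (1 + 2 * lp) ≤ 8 * p := by
    have h1 : (1 + lp) ^ 2 ≤ (2 * Real.sqrt p) ^ 2 := pow_le_pow_left₀ (by linarith) hlp 2
    have h2 : (2 * Real.sqrt p) ^ 2 = 4 * p := by rw [mul_pow, hsq]; norm_num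
    have h3 : (1 + lp) * (1 + 2 * lp) ≤ (1 + lp) * (2 * (1 + lp)) :=
      mul_le_mul_of_nonneg_left (by linarith) (by linarith)
    have h4 : (1 + lp) * (2 * (1 + lp)) = 2 * (1 + lp) ^ 2 := by ring
    linarith
  -- the product of the two logarithmic factors
  have hprod : (W + L2V) * L2V ≤ 96 * (a * b) * p * LQ ^ 2 * LB := by
    have h := mul_le_mul hWL hL2V' hL2V0 (by positivity)
    calc (W + L2V) * L2V ≤ (6 * b * (1 + 2 * lp) * LQ * LB) * (2 * a * (1 + lp) * LQ) := h
      _ = 12 * (a * b) * ((1 + lp) * (1 + 2 * lp)) * LQ ^ 2 * LB := by ring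
      _ ≤ 12 * (a * b) * (8 * p) * LQ ^ 2 * LB := by
          have : 0 ≤ 12 * (a * b) := by positivity
          have hL : 0 ≤ LQ ^ 2 * LB := by positivity
          apply mul_le_mul_of_nonneg_right _ (by positivity)
          apply mul_le_mul_of_nonneg_right _ (by positivity)
          exact mul_le_mul_of_nonneg_left hlp2 this
      _ = 96 * (a * b) * p * LQ ^ 2 * LB := by ring
  -- `a b ≤ 49 n⁴ ≤ 49 · 16ⁿ`
  have hab : a * b ≤ 49 * (16 : ℝ) ^ n := by
    have hnn : (n : ℝ) ≤ (n : ℝ) ^ 2 := by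
      rw [sq]; exact le_mul_of_one_le_left hn0.le hn1
    have ha5 : a ≤ 5 * (n : ℝ) ^ 2 := by rw [ha]; linarith
    have hb7 : b ≤ 7 * (n : ℝ) ^ 2 := by rw [hb]; linarith
    have h16 := pow_four_le_sixteen_pow n
    have hn4 : (0 : ℝ) ≤ (n : ℝ) ^ 4 := pow_nonneg hn0.le 4
    calc a * b ≤ (5 * (n : ℝ) ^ 2) * (7 * (n : ℝ) ^ 2) := mul_le_mul ha5 hb7 (by positivity) (by positivity)
      _ = 35 * (n : ℝ) ^ 4 := by ring
      _ ≤ 49 * (16 : ℝ) ^ n := by linarith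
  -- powers of `n`
  have hnpow : (n : ℝ) ^ (c₂ * n) * (n : ℝ) ^ (c₄ * n) = (n : ℝ) ^ ((c₂ + c₄) * n) := by
    rw [← Real.rpow_add hn0]
    congr 1; ring
  have hLB2 : LB ≤ LB ^ 2 := by
    rw [sq]; exact le_mul_of_one_le_left (by linarith) hLB
  -- assemble
  have hA : 0 ≤ c₁ ^ n * (n : ℝ) ^ (c₂ * n) := by positivity
  have hB : 0 ≤ 2 ^ n * (n : ℝ) ^ (c₄ * n) * p * Ω := by positivity
  have hC0 : 0 ≤ (W + L2V) * L2V := by positivity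
  calc v ≤ Cn * PV * ((W + L2V) * L2V) := hv
    _ ≤ (c₁ ^ n * (n : ℝ) ^ (c₂ * n)) * (2 ^ n * (n : ℝ) ^ (c₄ * n) * p * Ω) *
          (96 * (a * b) * p * LQ ^ 2 * LB) := by
        apply mul_le_mul (mul_le_mul hCn hPV hPV0 hA) hprod hC0 (mul_nonneg hA hB)
    _ ≤ (c₁ ^ n * (n : ℝ) ^ (c₂ * n)) * (2 ^ n * (n : ℝ) ^ (c₄ * n) * p * Ω) *
          (96 * (49 * (16 : ℝ) ^ n) * p * LQ ^ 2 * LB ^ 2) := by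
        apply mul_le_mul_of_nonneg_left _ (mul_nonneg hA hB)
        apply mul_le_mul _ hLB2 (by linarith) (by positivity)
        apply mul_le_mul_of_nonneg_right _ (by positivity)
        apply mul_le_mul_of_nonneg_right _ hp0.le
        exact mul_le_mul_of_nonneg_left hab (by norm_num)
    _ = 4704 * (c₁ ^ n * 2 ^ n * (16 : ℝ) ^ n) * ((n : ℝ) ^ (c₂ * n) * (n : ℝ) ^ (c₄ * n)) *
          p ^ 2 * Ω * LB ^ 2 * LQ ^ 2 := by ring
    _ = 4704 * (32 * c₁) ^ n * (n : ℝ) ^ ((c₂ + c₄) * n) * p ^ 2 * Ω * LB ^ 2 * LQ ^ 2 := by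
        rw [hnpow, mul_pow, show (32 : ℝ) ^ n = 2 ^ n * 16 ^ n by rw [← mul_pow]; norm_num]
        ring

end GlueGeneral

open Glue GlueGeneral

/-! ### The glue theorem, general WP-M exponent -/

/-- **WP-S glue, general exponent: principal reduction (heights `≤ A(m) p ∏ log qᵢ`,
`A(m) ≤ m^{c₄ m}`, `c₄ ≤ 2`) ∧ a Theorem-A-shaped bound (envelope `c₁^m m^{c₂ m}`) ⇒ the
prime-argument bound at every odd prime** with `K = 4704`, `L = 32 c₁`, `κ = c₂ + c₄`,
`σ = τ = τ₁ = 2` (the body of `KappaDoor.FinBoundAt p 4704 (32 c₁) (c₂ + c₄) 2 2 2`). For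
`A(m) = m^{2m}`, `c₄ = 2` this is `primePadicBoundAt_odd_of_principal`; book-keeping in
`GlueGeneral.bookkeeping_general`. [cite: StewartTijdeman1986, proof of Theorem 1 (the general glue with envelope A(m) ≤ m^{c₄ m})] -/
theorem primePadicBoundAt_odd_of_principal_general {A : ℕ → ℝ} {c₄ : ℝ} (hc₄ : c₄ ≤ 2)
    (hAenv : ∀ m, A m ≤ (m : ℝ) ^ (c₄ * m))
    (hM : ∀ (p : ℕ), p.Prime → p ≠ 2 → ∀ (m : ℕ) (q : Fin m → ℕ),
      (∀ i, (q i).Prime) → Function.Injective q → (∀ i, q i ≠ p) →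
      ∀ (e : Fin m → ℤ), e ≠ 0 → 1 ≤ padicValRat p (∏ i, (q i : ℚ) ^ e i - 1) →
      ∃ (α : Fin m → ℚ) (e' : Fin m → ℤ),
        (∀ j, α j ≠ 0 ∧ 1 ≤ padicValRat p (α j - 1)) ∧
        (∀ μ : Fin m → ℤ, ∏ j, α j ^ μ j = 1 → μ = 0) ∧
        (∀ T : Finset (Fin m), T.Nonempty → ¬ IsSquare (∏ j ∈ T, α j)) ∧
        e' ≠ 0 ∧ ∏ i, (q i : ℚ) ^ e i = ∏ j, α j ^ e' j ∧
        (∏ j, logHeight₁ (α j)) ≤ A m * p * ∏ i, Real.log (q i) ∧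
        (∀ j, (|e' j| : ℝ) ≤
          (m : ℝ) ^ (2 * m) * p * (∏ i, Real.log (q i)) * (Finset.univ.sup fun i => (e i).natAbs)) ∧
        (∀ j, Real.log p ≤ 2 * logHeight₁ (α j)))
    {C : ℕ → ℝ} {r : ℕ → ℕ} {c₁ c₂ : ℝ} (hc₁ : 1 ≤ c₁)
    (hC : ∀ m, 0 ≤ C m ∧ C m ≤ c₁ ^ m * (m : ℝ) ^ (c₂ * m))
    (hA : ∀ (p : ℕ), p.Prime → p ≠ 2 →
      ∀ (m : ℕ) (α : Fin m → ℚ) (b : Fin m → ℤ) (V : Fin m → ℝ) (Vmax W : ℝ),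
        (∀ j, α j ≠ 0 ∧ 1 ≤ padicValRat p (α j - 1)) →
        (∀ μ : Fin m → ℤ, ∏ j, α j ^ μ j = 1 → μ = 0) →
        (∀ T : Finset (Fin m), T.Nonempty → ¬ IsSquare (∏ j ∈ T, α j)) →
        (∀ j, logHeight₁ (α j) ≤ V j) → (∀ j, Real.log p ≤ V j) → (∀ j, V j ≤ Vmax) →
        b ≠ 0 → (∀ j, Real.log (max 3 (|b j| : ℝ)) ≤ W) →
        (padicValRat p (∏ j, α j ^ b j - 1) : ℝ) * Real.log p ≤
          C m * (∏ j, V j) * (W + Real.log (2 * Vmax)) * Real.log (2 * Vmax) / Real.log p ^ r m)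
    {p : ℕ} (hp : p.Prime) (hp2 : p ≠ 2) (n : ℕ) (q : Fin n → ℕ) (e : Fin n → ℤ)
    (hq : ∀ i, (q i).Prime) (hinj : Function.Injective q) (hqp : ∀ i, q i ≠ p) (he : e ≠ 0)
    (hne1 : ∏ i, ((q i : ℚ)) ^ e i ≠ 1) :
    (padicValRat p (∏ i, ((q i : ℚ)) ^ e i - 1) : ℝ) ≤
      4704 * (32 * c₁) ^ n * (n : ℝ) ^ ((c₂ + c₄) * n) * (p : ℝ) ^ (2 : ℝ) * (∏ i, Real.log (q i)) *
        Real.log (max 3 ((Finset.univ.sup fun i => (e i).natAbs : ℕ) : ℝ)) ^ 2 *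
        Real.log (max 3 (∏ i, ((q i : ℕ) : ℝ))) ^ 2 := by
  classical
  -- `n ≥ 1` (else `e = 0`)
  have hn : 1 ≤ n := by
    rcases Nat.eq_zero_or_pos n with h0 | h0
    · subst h0; exact absurd (Subsingleton.elim e 0) he
    · exact h0
  have hn0 : (0 : ℝ) < n := by exact_mod_cast (show 0 < n by omega)
  -- `p ≥ 3`
  have hp3 : 3 ≤ p := by
    have := hp.two_le
    omega
  have hp3R : (3 : ℝ) ≤ p := by exact_mod_cast hp3
  have hpR0 : (0 : ℝ) < p := by linarith
  -- the quantities of the statement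
  set Ω : ℝ := ∏ i, Real.log (q i) with hΩ
  set P : ℝ := ∏ i, ((q i : ℕ) : ℝ) with hP
  set B : ℕ := Finset.univ.sup fun i => (e i).natAbs with hB
  set LQ : ℝ := Real.log (max 3 P) with hLQ
  set LB : ℝ := Real.log (max 3 (B : ℝ)) with hLB
  set lp : ℝ := Real.log p with hlp
  have hq2 : ∀ i, 2 ≤ q i := fun i => (hq i).two_le
  have hΩ0 : 0 < Ω := Finset.prod_pos fun i _ => Real.log_pos (by exact_mod_cast hq2 i)
  have hl3 : 1 ≤ Real.log 3 := by
    rw [Real.le_log_iff_exp_le (by norm_num)]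
    exact Real.exp_one_lt_d9.le.trans (by norm_num)
  have hLQ1 : 1 ≤ LQ := hl3.trans (Real.log_le_log (by norm_num) (le_max_left _ _))
  have hLB1 : 1 ≤ LB := hl3.trans (Real.log_le_log (by norm_num) (le_max_left _ _))
  have hlp1 : 1 ≤ lp := hl3.trans (Real.log_le_log (by norm_num) hp3R)
  have hlps : 1 + lp ≤ 2 * Real.sqrt p := by
    have hs : 0 < Real.sqrt p := Real.sqrt_pos.mpr hpR0
    have hlog : Real.log (Real.sqrt p) ≤ Real.sqrt p - 1 := Real.log_le_sub_one_of_pos hs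
    have h2 : Real.log (Real.sqrt p) = Real.log p / 2 := Real.log_sqrt hpR0.le
    rw [hlp]; linarith
  have hlogΩ : Real.log Ω ≤ LQ := log_prod_log_le q hq2
  -- the right-hand side is nonnegative: the case `ord_p ≤ 0`
  have hRHS0 : 0 ≤ 4704 * (32 * c₁) ^ n * (n : ℝ) ^ ((c₂ + c₄) * n) * (p : ℝ) ^ (2 : ℝ) * Ω *
      LB ^ 2 * LQ ^ 2 := by
    have : 0 ≤ (32 * c₁) ^ n := pow_nonneg (by linarith) n
    positivity
  by_cases hv : padicValRat p (∏ i, ((q i : ℚ)) ^ e i - 1) ≤ 0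
  · exact le_trans (by exact_mod_cast hv) hRHS0
  have hv1 : 1 ≤ padicValRat p (∏ i, ((q i : ℚ)) ^ e i - 1) := by omega
  -- WP-M
  obtain ⟨α, e', h1, h2, h3, h4, h5, h6, h7, h8⟩ := hM p hp hp2 n q hq hinj hqp e he hv1
  -- the sizes fed to Theorem A
  set V : Fin n → ℝ := fun j => max (logHeight₁ (α j)) lp with hV
  have hVh : ∀ j, logHeight₁ (α j) ≤ V j := fun j => le_max_left _ _
  have hVp : ∀ j, Real.log p ≤ V j := fun j => le_max_right _ _
  have hV1 : ∀ j, 1 ≤ V j := fun j => hlp1.trans (hVp j)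
  have hV2 : ∀ j, V j ≤ 2 * logHeight₁ (α j) := fun j =>
    max_le (by linarith [zero_le_logHeight₁ (α j)]) (h8 j)
  set PV : ℝ := ∏ j, V j with hPV
  have hPV1 : 1 ≤ PV :=
    Finset.prod_induction _ (fun x => 1 ≤ x) (fun _ _ ha hb => one_le_mul_of_one_le_of_one_le ha hb)
      le_rfl (fun j _ => hV1 j)
  have hVle : ∀ j, V j ≤ PV := fun j => le_prod_of_one_le _ _ (fun i _ => hV1 i) (Finset.mem_univ j)
  have hnc₄ : (0 : ℝ) < (n : ℝ) ^ (c₄ * n) := Real.rpow_pos_of_pos hn0 _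
  have hPVle : PV ≤ 2 ^ n * (n : ℝ) ^ (c₄ * n) * p * Ω := by
    calc PV ≤ ∏ j, (2 * logHeight₁ (α j)) :=
          Finset.prod_le_prod (fun j _ => zero_le_one.trans (hV1 j)) fun j _ => hV2 j
      _ = 2 ^ n * ∏ j, logHeight₁ (α j) := by
          rw [Finset.prod_mul_distrib, Finset.prod_const, Finset.card_univ, Fintype.card_fin]
      _ ≤ 2 ^ n * (A n * p * Ω) := mul_le_mul_of_nonneg_left h6 (by positivity)
      _ ≤ 2 ^ n * ((n : ℝ) ^ (c₄ * n) * p * Ω) :=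
          mul_le_mul_of_nonneg_left
            (mul_le_mul_of_nonneg_right (mul_le_mul_of_nonneg_right (hAenv n) hpR0.le) hΩ0.le)
            (by positivity)
      _ = _ := by ring
  set B' : ℝ := (n : ℝ) ^ (2 * n) * p * Ω * B with hB'
  set W : ℝ := Real.log (max 3 B') with hW
  have hWj : ∀ j, Real.log (max 3 (|e' j| : ℝ)) ≤ W := fun j =>
    Real.log_le_log (lt_of_lt_of_le (by norm_num) (le_max_left _ _)) (max_le_max le_rfl (h7 j))
  -- Theorem A
  have key := hA p hp hp2 n α e' V PV W h1 h2 h3 hVh hVp hVle h4 hWj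
  rw [← h5] at key
  -- remove `log p` on both sides
  set L2V : ℝ := Real.log (2 * PV) with hL2V
  have hL2V0 : 0 ≤ L2V := Real.log_nonneg (by linarith)
  have hW0 : 0 ≤ W := Real.log_nonneg (le_trans (by norm_num) (le_max_left _ _))
  have hCn0 : 0 ≤ C n := (hC n).1
  have hX0 : 0 ≤ C n * PV * (W + L2V) * L2V := by positivity
  have hlppow : 1 ≤ Real.log p ^ r n := one_le_pow₀ hlp1
  set v : ℝ := (padicValRat p (∏ i, ((q i : ℚ)) ^ e i - 1) : ℝ) with hvdef
  have hv0 : 0 ≤ v := by rw [hvdef]; exact_mod_cast (le_trans zero_le_one hv1)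
  have hvle : v ≤ C n * PV * ((W + L2V) * L2V) := by
    have h1' : v ≤ v * Real.log p := le_mul_of_one_le_right hv0 hlp1
    have h2' : C n * PV * (W + L2V) * L2V / Real.log p ^ r n ≤ C n * PV * (W + L2V) * L2V :=
      div_le_self hX0 hlppow
    calc v ≤ v * Real.log p := h1'
      _ ≤ C n * PV * (W + L2V) * L2V / Real.log p ^ r n := key
      _ ≤ C n * PV * (W + L2V) * L2V := h2'
      _ = C n * PV * ((W + L2V) * L2V) := by ring
  -- `L2V ≤ (2n² + n + 2) + lp + LQ`
  have hlogn : Real.log n ≤ n := (Real.log_le_sub_one_of_pos hn0).trans (by linarith)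
  have hn2n : Real.log ((n : ℝ) ^ (2 * n)) ≤ 2 * (n : ℝ) ^ 2 := by
    rw [Real.log_pow]
    have h := mul_le_mul_of_nonneg_left hlogn (by positivity : (0 : ℝ) ≤ ((2 * n : ℕ) : ℝ))
    calc ((2 * n : ℕ) : ℝ) * Real.log n ≤ ((2 * n : ℕ) : ℝ) * n := h
      _ = 2 * (n : ℝ) ^ 2 := by push_cast; ring
  have hlogn0 : 0 ≤ Real.log n := Real.log_nonneg (by exact_mod_cast hn)
  have hnc₄n : Real.log ((n : ℝ) ^ (c₄ * n)) ≤ 2 * (n : ℝ) ^ 2 := by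
    rw [Real.log_rpow hn0]
    calc c₄ * n * Real.log n ≤ 2 * n * Real.log n :=
          mul_le_mul_of_nonneg_right (mul_le_mul_of_nonneg_right hc₄ hn0.le) hlogn0
      _ ≤ 2 * n * n := mul_le_mul_of_nonneg_left hlogn (by positivity)
      _ = 2 * (n : ℝ) ^ 2 := by ring
  have hL2Vle : L2V ≤ (2 * (n : ℝ) ^ 2 + n + 2) + lp + LQ := by
    have hpos : 0 < 2 * PV := by linarith
    have hle : 2 * PV ≤ 2 * 2 ^ n * (n : ℝ) ^ (c₄ * n) * p * Ω := by linarith [hPVle]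
    have hnn : (0 : ℝ) < (n : ℝ) ^ (c₄ * n) := hnc₄
    calc L2V ≤ Real.log (2 * 2 ^ n * (n : ℝ) ^ (c₄ * n) * p * Ω) := Real.log_le_log hpos hle
      _ = Real.log 2 + n * Real.log 2 + Real.log ((n : ℝ) ^ (c₄ * n)) + lp + Real.log Ω := by
          rw [Real.log_mul (by positivity) hΩ0.ne', Real.log_mul (by positivity) hpR0.ne',
            Real.log_mul (by positivity) hnn.ne', Real.log_mul (by norm_num) (by positivity),
            Real.log_pow]
      _ ≤ 1 + n * 1 + 2 * (n : ℝ) ^ 2 + lp + LQ := by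
          have h2 : Real.log 2 ≤ 1 := by linarith [Real.log_two_lt_d9]
          have : (n : ℝ) * Real.log 2 ≤ n * 1 := mul_le_mul_of_nonneg_left h2 hn0.le
          linarith
      _ = (2 * (n : ℝ) ^ 2 + n + 2) + lp + LQ - 1 := by ring
      _ ≤ (2 * (n : ℝ) ^ 2 + n + 2) + lp + LQ := by linarith
  -- `W ≤ 2n² + lp + LQ + LB`
  have hWle : W ≤ 2 * (n : ℝ) ^ 2 + lp + LQ + LB := by
    have hΩ1 : Ω ≤ max 1 Ω := le_max_right _ _
    have hm1 : (1 : ℝ) ≤ max 1 Ω := le_max_left _ _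
    have hBle : (B : ℝ) ≤ max 3 (B : ℝ) := le_max_right _ _
    have h3le : (3 : ℝ) ≤ max 3 (B : ℝ) := le_max_left _ _
    have hnn : (1 : ℝ) ≤ (n : ℝ) ^ (2 * n) := one_le_pow₀ (by exact_mod_cast hn)
    set M : ℝ := (n : ℝ) ^ (2 * n) * p * max 1 Ω * max 3 (B : ℝ) with hM
    have hB'M : B' ≤ M := by
      rw [hB', hM]
      apply mul_le_mul (mul_le_mul_of_nonneg_left hΩ1 (by positivity)) hBle (Nat.cast_nonneg _)
        (by positivity)
    have h3M : (3 : ℝ) ≤ M := by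
      rw [hM]
      have h1 : (3 : ℝ) ≤ (n : ℝ) ^ (2 * n) * p := by
        calc (3 : ℝ) = 1 * 3 := by ring
          _ ≤ (n : ℝ) ^ (2 * n) * p := mul_le_mul hnn hp3R (by norm_num) (by positivity)
      calc (3 : ℝ) = 3 * 1 * 1 := by ring
        _ ≤ (n : ℝ) ^ (2 * n) * p * max 1 Ω * max 3 (B : ℝ) :=
            mul_le_mul (mul_le_mul h1 hm1 zero_le_one (by positivity)) (by linarith) zero_le_one
              (by positivity)
    have hmaxM : max 3 B' ≤ M := max_le h3M hB'M
    have hM0 : 0 < M := by linarith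
    have hlogmax1 : Real.log (max 1 Ω) ≤ LQ := by
      rw [hLQ]
      apply Real.log_le_log (by positivity)
      refine max_le (le_trans (by norm_num) (le_max_left _ _)) (le_trans ?_ (le_max_right _ _))
      exact Finset.prod_le_prod (fun i _ => (Real.log_pos (by exact_mod_cast hq2 i)).le)
        fun i _ => (Real.log_le_sub_one_of_pos (by exact_mod_cast (by linarith [hq2 i] : 0 < q i))).trans
          (by linarith)
    calc W ≤ Real.log M := Real.log_le_log (lt_of_lt_of_le (by norm_num) (le_max_left _ _)) hmaxM
      _ = Real.log ((n : ℝ) ^ (2 * n)) + lp + Real.log (max 1 Ω) + LB := by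
          rw [hM, Real.log_mul (by positivity) (by positivity), Real.log_mul (by positivity) (by positivity),
            Real.log_mul (by positivity) hpR0.ne']
      _ ≤ 2 * (n : ℝ) ^ 2 + lp + LQ + LB := by linarith
  -- conclude
  have hfinal := bookkeeping_general (c₂ := c₂) (c₄ := c₄) hn hp3R hc₁ hΩ0 hLQ1 hLB1 hlp1 hlps
    (hC n).2 (zero_le_one.trans hPV1) hPVle hL2V0 hL2Vle hW0 hWle hvle
  rw [Real.rpow_two]
  exact hfinal

end Literature.NumberTheory.Transcendental.StewartYu

end Part5

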